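import Mathlib
import Literature.NumberTheory.Sieve.IntervalResidueClassSieve
import HarnessLib

/-!
# Hardy–Littlewood–Chowla on average (Lichtman–Teräväinen 2022): the sieve bounds (Lemmas 2.3, 2.4, 2.11)

Topic `Literature/NumberTheory/Sieve`, companion of `HardyLittlewoodChowla.lean` (the named facts
`lichtmanTeravainen2022_hlc_avg`, `lichtmanTeravainen2022_hlc_avg_liouville` = J. D. Lichtman,
J. Teräväinen, *On the Hardy–Littlewood–Chowla conjecture on average*, Forum Math. Sigma 10 (2022)
e57, doi:10.1017/fms.2022.54, arXiv:2111.08912 [LichtmanTeravainen2022], Theorem 1.2 (i)), and of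
`HardyLittlewoodChowlaFourier.lean` / `HardyLittlewoodChowlaTuples.lean` (Prop. 3.2 and the
combinatorics of Prop. 2.7).  Everything in this file is PROVED; it introduces no definition and no
named fact.

This is the sieve layer of the discharge of those facts (held copy `paper:arxiv-2111.08912`, §2.2
and §2.3): the two "standard sieve upper bounds" the paper quotes —

* **Lemma 2.3** (Selberg's bound for prime `k`-tuples, [Opera de Cribro], uniform in the shifts)
  together with **Lemma 2.4** (`𝔖(ℋ) ≪_k ∏_{i<j} (|hᵢ−hⱼ|/φ(|hᵢ−hⱼ|))^k`), in the `Λ`-weighted form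
  in which Proposition 2.7 and §4 (`E_g(X) ≍ 1`) consume them:
  `LichtmanTeravainen2022.sum_prod_vonMangoldt_le` —
  `∑_{n ≤ Y} ∏_{s ∈ T} Λ(n+s) ≤ C(k) (Y (∏_{s≠s'} |s−s'|/φ(|s−s'|))^k + Y^{3/4})` for `#T ≤ k`,
  all shifts `≤ Y`;
* **Lemma 2.11** (primes against the integers `𝒩` free of prime factors from an interval `[P, Q]`,
  which the paper deduces from Henriot's discriminant-uniform Nair–Tenenbaum theorem):
  `LichtmanTeravainen2022.sum_indicator_prod_vonMangoldt_le` —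
  `∑_{n ≤ X} 1_𝒩(n+h) ∏_{a ∈ A} Λ(n+a) ≤ C(k) (X 𝔖_A (log P/log Q) ∏_a |h−a|/φ(|h−a|) + X^{3/4})`
  for `#A ≤ k`, `h ∉ A`, `2 ≤ P ≤ Q ≤ X^{1/4}` (better than printed in the exponent of
  `|h−a|/φ(|h−a|)`, which is `1` instead of `2^{ℓ+1}`).

Both come out of ONE sifted count, `LichtmanTeravainen2022.card_sifted_le`: the tree's fundamental
lemma for an interval sifted by prescribed residue classes
(`Literature.NumberTheory.Sieve.IntervalClassSieve.abs_card_sub_le`, built on the proved uniform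
Fundamental Lemma `SieveSequence.fundamental_lemma_uniform_holds`) applied to the classes `−a (mod p)`,
`a ∈ A`, for all primes `p < M`, plus the class `−h (mod p)` for the primes `p ∈ [P, Q]` — exactly the
bookkeeping of the tree's proof of Lichtman 2020, (2.5) (`MoebiusShiftedPrimesSieveBound.lean`,
namespace `Lichtman2020`, whose comparison weights `sieveWeight` and Mertens estimates
`prod_primesLE_one_sub_inv_le`, `prod_sieveWeight_le` are reused).

## The argument (sub-namespace `LichtmanTeravainen2022`)

* classes: `mod_mem_image_neg_iff` (`n mod p ∈ {−a mod p} ↔ ∃ a ∈ A, p ∣ n + a`),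
  `neg_mod_eq_iff`, `card_image_neg_eq` (pairwise incongruent shifts remove `#A` classes);
* the count: `card_sifted_le` (level `L = z = M`: `≤ C X V + M²`), `card_sifted_le'` (no partial
  shift), `filter_sifted_eq_empty(')` (inadmissible tuples leave nothing);
* the main term: `prod_one_sub_card_le_mul` (modulo `p ∈ [P,Q]`, `p ∤ D_h = ∏|h−a|`, the class
  `−h` is new: `1 − ω(p)/p ≤ (1 − ν_p(A)/p)(1 − 1/p)`), `prod_one_sub_card_image_le`
  (Lemma 2.4: `∏_{p<M}(1 − ν_p(A)/p) ≤ (∏_{p<M}(1 − 1/p))^{#A} (Δ_A/φ(Δ_A))^{#A}`, Bernoulli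
  modulo `p ∤ Δ_A`, `≤ 1` modulo `p ∣ Δ_A`), `cast_prod_div_totient_le` (`φ` is super-multiplicative);
* the `Λ`-weights: `prod_vonMangoldt_shift_le` (`Λ ≤ log(2Y+3)`), `eq_prime_pow_of_dvd` and
  `card_smallPrimePowers_le` (on the support a sifted-out `n + s` is a power of a prime `< M`; there
  are `≤ M(log₂N + 1)` of those), `sum_filter_prod_vonMangoldt_le`;
* constants: sifting threshold `m = ⌊Y^{1/4}⌋ + 2`, `log(2Y+3) ≤ 8 log m`,
  `(log(2Y+3))^{k+1} ≪_k Y^{1/4}`.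

## References

* J. D. Lichtman, J. Teräväinen, Forum Math. Sigma 10 (2022) e57, arXiv:2111.08912, §2.2
  (Lemmas 2.3, 2.4), §2.3 (Lemma 2.11). [cite: LichtmanTeravainen2022, Lemmas 2.3, 2.4 and 2.11]
* J. Friedlander, H. Iwaniec, *Opera de Cribro* (2010), Thm 6.9, Cor. 6.10 (the paper's [Opera]).
  [cite: FriedlanderIwaniecOpera2010, Thm. 6.9 and Cor. 6.10]
-/

noncomputable section

open Finset
open scoped ArithmeticFunction.vonMangoldt

namespace Literature.NumberTheory.Sieve

namespace LichtmanTeravainen2022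

open Lichtman2020 (dvd_add_iff_mod_eq sieveWeight sieveWeight_nonneg sieveWeight_le_one
  prod_sieveWeight_le prod_primesLE_one_sub_inv_le totient_div_le_prod)

/-! ### Residue classes of a set of shifts -/

/-- The classes removed by sifting the shifts `a ∈ A` modulo `p`:
`n mod p ∈ {(-a) mod p : a ∈ A} ↔ ∃ a ∈ A, p ∣ n + a` (`p > 0`). [folklore] -/
theorem mod_mem_image_neg_iff {p : ℕ} (hp : 0 < p) (A : Finset ℕ) (n : ℕ) :
    n % p ∈ A.image (fun a => (p - a % p) % p) ↔ ∃ a ∈ A, p ∣ n + a := by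
  simp only [Finset.mem_image]
  constructor
  · rintro ⟨a, ha, h⟩
    exact ⟨a, ha, (dvd_add_iff_mod_eq hp n a).mpr h.symm⟩
  · rintro ⟨a, ha, h⟩
    exact ⟨a, ha, ((dvd_add_iff_mod_eq hp n a).mp h).symm⟩

/-- The removed classes are `< p` (`p > 0`). [folklore] -/
theorem image_neg_lt {p : ℕ} (hp : 0 < p) (A : Finset ℕ) :
    ∀ r ∈ A.image (fun a => (p - a % p) % p), r < p := by
  intro r hr
  obtain ⟨a, _, rfl⟩ := Finset.mem_image.mp hr
  exact Nat.mod_lt _ hp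

/-- Two shifts give the same class modulo `p` iff they are congruent modulo `p`. [folklore] -/
theorem neg_mod_eq_iff {p : ℕ} (hp : 0 < p) (a b : ℕ) :
    (p - a % p) % p = (p - b % p) % p ↔ a % p = b % p := by
  constructor
  · intro h
    -- `r := (p - a % p) % p` satisfies `p ∣ r + a` and `p ∣ r + b`
    set r : ℕ := (p - a % p) % p with hr
    have hrp : r < p := Nat.mod_lt _ hp
    have ha : p ∣ r + a := (dvd_add_iff_mod_eq hp r a).mpr (by rw [Nat.mod_eq_of_lt hrp])
    have hb : p ∣ r + b := (dvd_add_iff_mod_eq hp r b).mpr (by rw [Nat.mod_eq_of_lt hrp, h])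
    rcases le_total a b with hab | hab
    · have : p ∣ (r + b) - (r + a) := Nat.dvd_sub hb ha
      rw [Nat.add_sub_add_left] at this
      exact (Nat.modEq_iff_dvd' hab).mpr this
    · have : p ∣ (r + a) - (r + b) := Nat.dvd_sub ha hb
      rw [Nat.add_sub_add_left] at this
      exact ((Nat.modEq_iff_dvd' hab).mpr this).symm
  · intro h
    rw [h]

/-- If the shifts of `A` are pairwise incongruent modulo `p`, exactly `#A` classes are removed.
[folklore] -/
theorem card_image_neg_eq {p : ℕ} (hp : 0 < p) {A : Finset ℕ}
    (hA : ∀ a ∈ A, ∀ b ∈ A, a % p = b % p → a = b) :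
    #(A.image (fun a => (p - a % p) % p)) = #A :=
  Finset.card_image_of_injOn fun a ha b hb h => hA a ha b hb ((neg_mod_eq_iff hp a b).mp h)

/-! ### The sifted count -/

/-- **The upper-bound sieve for shifted tuples with one partially sifted shift.**  For every `D`
there is `C = C(D) > 0` such that for all `X, M ≥ 2`, all finite sets `A` of shifts and shifts `h`
with `#A + 1 ≤ D`, and all real `P, Q`: if modulo every prime `p < M` the removed classes
(`-a`, `a ∈ A`, and also `-h` when `P ≤ p ≤ Q`) do not exhaust `ℤ/p`, then
`#{1 ≤ n ≤ X : p ∤ n + a (a ∈ A, p < M) and p ∤ n + h (P ≤ p ≤ Q, p < M)}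
  ≤ C X ∏_{p < M} (1 − ω(p)/p) + M²`, `ω(p)` the number of removed classes.  This is the tree's
fundamental lemma for an interval sifted by prescribed classes
(`IntervalClassSieve.abs_card_sub_le`, level `L = z = M`) — the "standard sieve upper bound
[Opera]" behind Lichtman–Teräväinen's Lemma 2.3 (Selberg's bound for prime tuples) and Lemma 2.11.
[cite: LichtmanTeravainen2022, Lemma 2.3 and Lemma 2.11] -/
theorem card_sifted_le (D : ℕ) : ∃ C : ℝ, 0 < C ∧
    ∀ (X M : ℕ) (A : Finset ℕ) (h : ℕ) (P Q : ℝ), #A + 1 ≤ D → 2 ≤ M →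
      (∀ p ∈ Nat.primesBelow M,
        #((if P ≤ (p : ℝ) ∧ (p : ℝ) ≤ Q then insert h A else A).image
          fun a => (p - a % p) % p) < p) →
      (#{n ∈ Icc 1 X | (∀ a ∈ A, ∀ p ∈ Nat.primesBelow M, ¬ p ∣ n + a) ∧
          ∀ p ∈ Nat.primesBelow M, P ≤ (p : ℝ) → (p : ℝ) ≤ Q → ¬ p ∣ n + h} : ℝ) ≤
        C * X * ∏ p ∈ Nat.primesBelow M,
          (1 - (#((if P ≤ (p : ℝ) ∧ (p : ℝ) ≤ Q then insert h A else A).image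
            fun a => (p - a % p) % p) : ℝ) / p) + (M : ℝ) ^ 2 := by
  obtain ⟨C, hC, hmain⟩ := IntervalClassSieve.abs_card_sub_le D
  refine ⟨1 + C, by positivity, ?_⟩
  intro X M A h P Q hD hM hadm
  classical
  -- the classes, extended by `∅` beyond `M`
  set Ωf : ℕ → Finset ℕ := fun p =>
    (if P ≤ (p : ℝ) ∧ (p : ℝ) ≤ Q then insert h A else A).image fun a => (p - a % p) % p
    with hΩf
  set Ω : ℕ → Finset ℕ := fun p => if p < M then Ωf p else ∅ with hΩ
  have hΩlt : ∀ p : ℕ, p.Prime → ∀ r ∈ Ω p, r < p := by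
    intro p hp r hr
    simp only [hΩ] at hr
    split_ifs at hr with hpM
    · exact image_neg_lt hp.pos _ r hr
    · simp at hr
  have hΩle : ∀ p : ℕ, p.Prime → #(Ω p) ≤ D := by
    intro p hp
    simp only [hΩ]
    split_ifs with hpM
    · refine (Finset.card_image_le).trans (le_trans ?_ hD)
      split_ifs
      · exact Finset.card_insert_le _ _
      · exact Nat.le_succ _
    · simp
  have hΩp : ∀ p : ℕ, p.Prime → #(Ω p) < p := by
    intro p hp
    simp only [hΩ]
    split_ifs with hpM
    · exact hadm p (Nat.mem_primesBelow.mpr ⟨hpM, hp⟩)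
    · rw [Finset.card_empty]; exact hp.pos
  have hMr : (2 : ℝ) ≤ M := by exact_mod_cast hM
  have key := hmain X Ω hΩlt hΩle hΩp M M hMr le_rfl
  rw [Nat.ceil_natCast] at key
  -- the product is over `p < M`, where `Ω p = Ωf p`
  have hprod : ∏ p ∈ Nat.primesBelow M, (1 - (#(Ω p) : ℝ) / p) =
      ∏ p ∈ Nat.primesBelow M, (1 - (#(Ωf p) : ℝ) / p) := by
    refine Finset.prod_congr rfl fun p hp => ?_
    have hpM : p < M := (Nat.mem_primesBelow.mp hp).1
    simp only [hΩ, if_pos hpM]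
  have hV0 : 0 ≤ ∏ p ∈ Nat.primesBelow M, (1 - (#(Ω p) : ℝ) / p) := by
    refine Finset.prod_nonneg fun p hp => ?_
    have hpp : p.Prime := (Nat.mem_primesBelow.mp hp).2
    rw [sub_nonneg, div_le_one (by exact_mod_cast hpp.pos)]
    exact_mod_cast (hΩp p hpp).le
  -- our set is contained in the sifted set
  have hsub : {n ∈ Icc 1 X | (∀ a ∈ A, ∀ p ∈ Nat.primesBelow M, ¬ p ∣ n + a) ∧
        ∀ p ∈ Nat.primesBelow M, P ≤ (p : ℝ) → (p : ℝ) ≤ Q → ¬ p ∣ n + h} ⊆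
      {n ∈ Icc 1 X | ∀ p ∈ Nat.primesBelow M, n % p ∉ Ω p} := by
    intro n hn
    rw [Finset.mem_filter] at hn ⊢
    refine ⟨hn.1, fun p hp hmem => ?_⟩
    obtain ⟨hpM, hpp⟩ := Nat.mem_primesBelow.mp hp
    simp only [hΩ, if_pos hpM, hΩf] at hmem
    rw [mod_mem_image_neg_iff hpp.pos] at hmem
    obtain ⟨a, ha, hdvd⟩ := hmem
    split_ifs at ha with hPQ
    · rcases Finset.mem_insert.mp ha with rfl | ha'
      · exact hn.2.2 p hp hPQ.1 hPQ.2 hdvd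
      · exact hn.2.1 a ha' p hp hdvd
    · exact hn.2.1 a ha p hp hdvd
  have hexp : Real.exp (-(Real.log M / Real.log M)) ≤ 1 := by
    rw [Real.exp_le_one_iff, neg_nonpos]
    exact div_nonneg (Real.log_nonneg (by linarith)) (Real.log_nonneg (by linarith))
  have hX0 : (0 : ℝ) ≤ X := Nat.cast_nonneg _
  have hcount := (abs_sub_le_iff.mp key).1
  calc (#{n ∈ Icc 1 X | (∀ a ∈ A, ∀ p ∈ Nat.primesBelow M, ¬ p ∣ n + a) ∧
          ∀ p ∈ Nat.primesBelow M, P ≤ (p : ℝ) → (p : ℝ) ≤ Q → ¬ p ∣ n + h} : ℝ)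
      ≤ #{n ∈ Icc 1 X | ∀ p ∈ Nat.primesBelow M, n % p ∉ Ω p} := by
        exact_mod_cast Finset.card_le_card hsub
    _ ≤ X * ∏ p ∈ Nat.primesBelow M, (1 - (#(Ω p) : ℝ) / p) +
          (C * X * (∏ p ∈ Nat.primesBelow M, (1 - (#(Ω p) : ℝ) / p)) *
            Real.exp (-(Real.log M / Real.log M)) + (M : ℝ) ^ 2) := by linarith
    _ ≤ X * ∏ p ∈ Nat.primesBelow M, (1 - (#(Ω p) : ℝ) / p) +
          (C * X * (∏ p ∈ Nat.primesBelow M, (1 - (#(Ω p) : ℝ) / p)) * 1 + (M : ℝ) ^ 2) := by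
        gcongr
    _ = (1 + C) * X * ∏ p ∈ Nat.primesBelow M, (1 - (#(Ωf p) : ℝ) / p) + (M : ℝ) ^ 2 := by
        rw [hprod]; ring

/-! ### Congruent shifts and the discriminant -/

/-- `a ≡ b (mod p)` forces `p ∣ |a - b|`. [folklore] -/
theorem dvd_natAbs_sub_of_mod_eq {p a b : ℕ} (h : a % p = b % p) :
    p ∣ ((a : ℤ) - b).natAbs := by
  have h1 : (p : ℤ) ∣ (b : ℤ) - a := Nat.modEq_iff_dvd.mp h
  rw [← Int.natAbs_neg, neg_sub, ← Int.natCast_dvd]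
  exact h1

/-- The number of removed classes is at most `p`. [folklore] -/
theorem card_image_neg_le {p : ℕ} (hp : 0 < p) (A : Finset ℕ) :
    #(A.image (fun a => (p - a % p) % p)) ≤ p := by
  calc #(A.image (fun a => (p - a % p) % p)) ≤ #(Finset.range p) :=
        Finset.card_le_card fun r hr => Finset.mem_range.mpr (image_neg_lt hp A r hr)
    _ = p := Finset.card_range p

/-- **Comparison of the main terms.**  With `D_h = ∏_{a ∈ A} |h - a|`, modulo a prime
`p ∈ [P, Q]` not dividing `D_h` the class `-h` is new, so
`1 − ω(p)/p ≤ (1 − ν_p(A)/p)(1 − 1/p)`; hence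
`∏_{p<M} (1 − ω(p)/p) ≤ ∏_{p<M} (1 − ν_p(A)/p) · ∏_{p<M} c(p)` with Lichtman's comparison weights
`c(p) = sieveWeight P Q D_h p` (`= 1 − 1/p` if `p ∈ [P, Q]`, `p ∤ D_h`, else `1`).
[cite: LichtmanTeravainen2022, proof of Lemma 2.11] -/
theorem prod_one_sub_card_le_mul (A : Finset ℕ) (h : ℕ) (P Q : ℝ) (M : ℕ)
    (hadm : ∀ p ∈ Nat.primesBelow M,
      #((if P ≤ (p : ℝ) ∧ (p : ℝ) ≤ Q then insert h A else A).image
        fun a => (p - a % p) % p) < p) :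
    ∏ p ∈ Nat.primesBelow M,
        (1 - (#((if P ≤ (p : ℝ) ∧ (p : ℝ) ≤ Q then insert h A else A).image
          fun a => (p - a % p) % p) : ℝ) / p) ≤
      (∏ p ∈ Nat.primesBelow M, (1 - (#(A.image fun a => (p - a % p) % p) : ℝ) / p)) *
        ∏ p ∈ Nat.primesBelow M, sieveWeight P Q (∏ a ∈ A, ((h : ℤ) - a).natAbs) p := by
  rw [← Finset.prod_mul_distrib]
  refine Finset.prod_le_prod (fun p hp => ?_) (fun p hp => ?_)
  · have hpp : p.Prime := (Nat.mem_primesBelow.mp hp).2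
    rw [sub_nonneg, div_le_one (by exact_mod_cast hpp.pos)]
    exact_mod_cast (hadm p hp).le
  · have hpp : p.Prime := (Nat.mem_primesBelow.mp hp).2
    have hp0 : (0 : ℝ) < p := by exact_mod_cast hpp.pos
    set D : ℕ := ∏ a ∈ A, ((h : ℤ) - a).natAbs with hD
    by_cases hPQ : P ≤ (p : ℝ) ∧ (p : ℝ) ≤ Q
    · rw [if_pos hPQ]
      by_cases hdvd : p ∣ D
      · -- no new class is claimed: monotonicity
        have hw : sieveWeight P Q D p = 1 := by
          unfold sieveWeight; rw [if_neg (fun h' => h'.2 hdvd)]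
        rw [hw, mul_one]
        have hsub : A.image (fun a => (p - a % p) % p) ⊆
            (insert h A).image (fun a => (p - a % p) % p) :=
          Finset.image_subset_image (Finset.subset_insert _ _)
        have : (#(A.image (fun a => (p - a % p) % p)) : ℝ) ≤
            #((insert h A).image (fun a => (p - a % p) % p)) := by
          exact_mod_cast Finset.card_le_card hsub
        rw [sub_le_sub_iff_left]
        exact div_le_div_of_nonneg_right this hp0.le
      · -- the class of `-h` is new
        have hw : sieveWeight P Q D p = 1 - 1 / (p : ℝ) := by
          unfold sieveWeight; rw [if_pos ⟨hPQ, hdvd⟩]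
        have hnot : (p - h % p) % p ∉ A.image (fun a => (p - a % p) % p) := by
          intro hmem
          obtain ⟨a, ha, hah⟩ := Finset.mem_image.mp hmem
          have hmod : h % p = a % p := ((neg_mod_eq_iff hpp.pos a h).mp hah).symm
          exact hdvd ((dvd_natAbs_sub_of_mod_eq hmod).trans (Finset.dvd_prod_of_mem _ ha))
        rw [Finset.image_insert, Finset.card_insert_of_notMem hnot, hw]
        push_cast
        have hν : (0 : ℝ) ≤ #(A.image (fun a => (p - a % p) % p)) := Nat.cast_nonneg _
        have key : (1 - (#(A.image (fun a => (p - a % p) % p)) : ℝ) / p) * (1 - 1 / (p : ℝ)) -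
            (1 - ((#(A.image (fun a => (p - a % p) % p)) : ℝ) + 1) / p) =
            (#(A.image (fun a => (p - a % p) % p)) : ℝ) / p ^ 2 := by
          field_simp
          ring
        have : 0 ≤ (#(A.image (fun a => (p - a % p) % p)) : ℝ) / p ^ 2 := by positivity
        linarith
    · rw [if_neg hPQ]
      have hw : sieveWeight P Q D p = 1 := by
        unfold sieveWeight; rw [if_neg (fun h' => hPQ h'.1)]
      rw [hw, mul_one]

/-- `∏_{p ∈ T} (1 − 1/p)⁻¹ ≤ Δ/φ(Δ)` for any set `T` of prime factors of `Δ ≠ 0`. [folklore] -/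
theorem prod_inv_one_sub_le_div_totient {Δ : ℕ} (hΔ : Δ ≠ 0) {T : Finset ℕ}
    (hT : T ⊆ Δ.primeFactors) :
    ∏ p ∈ T, (1 - 1 / (p : ℝ))⁻¹ ≤ (Δ : ℝ) / Nat.totient Δ := by
  have h1 := totient_div_le_prod hΔ hT
  have hΔ0 : (0 : ℝ) < Δ := by exact_mod_cast Nat.pos_of_ne_zero hΔ
  have hφ0 : (0 : ℝ) < Nat.totient Δ := by exact_mod_cast Nat.totient_pos.mpr (Nat.pos_of_ne_zero hΔ)
  have hpos : 0 < ∏ p ∈ T, (1 - 1 / (p : ℝ)) := by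
    refine Finset.prod_pos fun p hp => ?_
    have h2 : (2 : ℝ) ≤ p := by exact_mod_cast (Nat.prime_of_mem_primeFactors (hT hp)).two_le
    have : 1 / (p : ℝ) ≤ 1 / 2 := one_div_le_one_div_of_le (by norm_num) h2
    linarith
  rw [Finset.prod_inv_distrib]
  calc (∏ p ∈ T, (1 - 1 / (p : ℝ)))⁻¹ ≤ ((Nat.totient Δ : ℝ) / Δ)⁻¹ := inv_anti₀ (by positivity) h1
    _ = (Δ : ℝ) / Nat.totient Δ := by rw [inv_div]

/-- **The main term of the tuple sieve against Mertens' product.**  With `ν_p(A)` the number of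
classes of `A` modulo `p` and `Δ_A = ∏_{a ≠ b ∈ A} |a − b|` (`≠ 0`):
`∏_{p<M} (1 − ν_p(A)/p) ≤ (∏_{p<M} (1 − 1/p))^{#A} (Δ_A/φ(Δ_A))^{#A}` — modulo `p ∤ Δ_A` all
`#A` classes are distinct and `1 − k/p ≤ (1 − 1/p)^k`; modulo `p ∣ Δ_A` the factor is `≤ 1`, and
`∏_{p ∣ Δ_A} (1 − 1/p)^{-1} = Δ_A/φ(Δ_A)` (Lichtman–Teräväinen, Lemma 2.4:
`𝔖(ℋ) ≪_k ∏_{i<j} (|hᵢ − hⱼ|/φ(|hᵢ − hⱼ|))^k`). [cite: LichtmanTeravainen2022, Lemma 2.4] -/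
theorem prod_one_sub_card_image_le (A : Finset ℕ) (M : ℕ) :
    ∏ p ∈ Nat.primesBelow M, (1 - (#(A.image fun a => (p - a % p) % p) : ℝ) / p) ≤
      (∏ p ∈ Nat.primesBelow M, (1 - 1 / (p : ℝ))) ^ #A *
        ((((∏ x ∈ A.offDiag, ((x.1 : ℤ) - x.2).natAbs : ℕ)) : ℝ) /
          Nat.totient (∏ x ∈ A.offDiag, ((x.1 : ℤ) - x.2).natAbs)) ^ #A := by
  classical
  set Δ : ℕ := ∏ x ∈ A.offDiag, ((x.1 : ℤ) - x.2).natAbs with hΔ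
  have hΔ0 : Δ ≠ 0 := by
    rw [hΔ]
    refine Finset.prod_ne_zero_iff.mpr fun x hx => ?_
    rw [Finset.mem_offDiag] at hx
    rw [Ne, Int.natAbs_eq_zero, sub_eq_zero, Nat.cast_inj]
    exact hx.2.2
  -- termwise weights
  set w : ℕ → ℝ := fun p => if p ∣ Δ then ((1 - 1 / (p : ℝ))⁻¹) ^ #A else 1 with hw
  have hterm : ∀ p ∈ Nat.primesBelow M,
      (1 - (#(A.image fun a => (p - a % p) % p) : ℝ) / p) ≤ (1 - 1 / (p : ℝ)) ^ #A * w p := by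
    intro p hp
    have hpp : p.Prime := (Nat.mem_primesBelow.mp hp).2
    have hp0 : (0 : ℝ) < p := by exact_mod_cast hpp.pos
    have hp2 : (2 : ℝ) ≤ p := by exact_mod_cast hpp.two_le
    have h1p : 0 < 1 - 1 / (p : ℝ) := by
      have : 1 / (p : ℝ) ≤ 1 / 2 := one_div_le_one_div_of_le (by norm_num) hp2
      linarith
    by_cases hdvd : p ∣ Δ
    · simp only [hw, if_pos hdvd]
      rw [← mul_pow, mul_inv_cancel₀ h1p.ne', one_pow, sub_le_self_iff]
      positivity
    · simp only [hw, if_neg hdvd, mul_one]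
      -- all classes are distinct modulo `p`
      have hinj : ∀ a ∈ A, ∀ b ∈ A, a % p = b % p → a = b := by
        intro a ha b hb hab
        by_contra hne
        apply hdvd
        have hx : (a, b) ∈ A.offDiag := Finset.mem_offDiag.mpr ⟨ha, hb, hne⟩
        exact (dvd_natAbs_sub_of_mod_eq hab).trans (Finset.dvd_prod_of_mem _ hx)
      rw [card_image_neg_eq hpp.pos hinj]
      -- Bernoulli
      have hB := one_add_mul_le_pow (show (-2 : ℝ) ≤ -(1 / (p : ℝ)) by
        have : 0 ≤ 1 / (p : ℝ) := by positivity
        linarith) #A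
      calc 1 - (#A : ℝ) / p = 1 + (#A : ℝ) * (-(1 / (p : ℝ))) := by ring
        _ ≤ (1 + -(1 / (p : ℝ))) ^ #A := hB
        _ = (1 - 1 / (p : ℝ)) ^ #A := by ring
  have hnonneg : ∀ p ∈ Nat.primesBelow M,
      0 ≤ (1 - (#(A.image fun a => (p - a % p) % p) : ℝ) / p) := by
    intro p hp
    have hpp : p.Prime := (Nat.mem_primesBelow.mp hp).2
    rw [sub_nonneg, div_le_one (by exact_mod_cast hpp.pos)]
    exact_mod_cast card_image_neg_le hpp.pos A
  -- the product of the weights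
  have hwprod : ∏ p ∈ Nat.primesBelow M, w p =
      (∏ p ∈ (Nat.primesBelow M).filter (· ∣ Δ), (1 - 1 / (p : ℝ))⁻¹) ^ #A := by
    rw [← Finset.prod_pow, Finset.prod_filter]
  have hT : (Nat.primesBelow M).filter (· ∣ Δ) ⊆ Δ.primeFactors := by
    intro p hp
    rw [Finset.mem_filter, Nat.mem_primesBelow] at hp
    exact Nat.mem_primeFactors.mpr ⟨hp.1.2, hp.2, hΔ0⟩
  have hwle : ∏ p ∈ Nat.primesBelow M, w p ≤ ((Δ : ℝ) / Nat.totient Δ) ^ #A := by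
    rw [hwprod]
    exact pow_le_pow_left₀ (Finset.prod_nonneg fun p hp => by
      have h2 : (2 : ℝ) ≤ p := by
        exact_mod_cast (Nat.prime_of_mem_primeFactors (hT hp)).two_le
      have : 1 / (p : ℝ) ≤ 1 / 2 := one_div_le_one_div_of_le (by norm_num) h2
      exact inv_nonneg.mpr (by linarith)) (prod_inv_one_sub_le_div_totient hΔ0 hT) _
  have hM0 : 0 ≤ (∏ p ∈ Nat.primesBelow M, (1 - 1 / (p : ℝ))) ^ #A := by
    refine pow_nonneg (Finset.prod_nonneg fun p hp => ?_) _
    have h2 : (2 : ℝ) ≤ p := by exact_mod_cast (Nat.mem_primesBelow.mp hp).2.two_le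
    have : 1 / (p : ℝ) ≤ 1 / 2 := one_div_le_one_div_of_le (by norm_num) h2
    linarith
  calc ∏ p ∈ Nat.primesBelow M, (1 - (#(A.image fun a => (p - a % p) % p) : ℝ) / p)
      ≤ ∏ p ∈ Nat.primesBelow M, ((1 - 1 / (p : ℝ)) ^ #A * w p) := Finset.prod_le_prod hnonneg hterm
    _ = (∏ p ∈ Nat.primesBelow M, (1 - 1 / (p : ℝ))) ^ #A * ∏ p ∈ Nat.primesBelow M, w p := by
        rw [Finset.prod_mul_distrib, Finset.prod_pow]
    _ ≤ (∏ p ∈ Nat.primesBelow M, (1 - 1 / (p : ℝ))) ^ #A * ((Δ : ℝ) / Nat.totient Δ) ^ #A :=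
        mul_le_mul_of_nonneg_left hwle hM0

/-- **Super-multiplicativity of `φ`**: `(∏ f)/φ(∏ f) ≤ ∏ f/φ(f)` for nonzero naturals. [folklore] -/
theorem cast_prod_div_totient_le {ι : Type*} (s : Finset ι) (f : ι → ℕ) (hf : ∀ i ∈ s, f i ≠ 0) :
    ((∏ i ∈ s, f i : ℕ) : ℝ) / Nat.totient (∏ i ∈ s, f i) ≤
      ∏ i ∈ s, ((f i : ℝ) / Nat.totient (f i)) := by
  classical
  induction s using Finset.induction_on with
  | empty => simp
  | insert a s ha ih =>
    rw [Finset.prod_insert ha, Finset.prod_insert ha]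
    have hfa : f a ≠ 0 := hf a (Finset.mem_insert_self a s)
    have hfs : ∀ i ∈ s, f i ≠ 0 := fun i hi => hf i (Finset.mem_insert_of_mem hi)
    have hP : ∏ i ∈ s, f i ≠ 0 := Finset.prod_ne_zero_iff.mpr hfs
    have hφa : (0 : ℝ) < Nat.totient (f a) := by
      exact_mod_cast Nat.totient_pos.mpr (Nat.pos_of_ne_zero hfa)
    have hφP : (0 : ℝ) < Nat.totient (∏ i ∈ s, f i) := by
      exact_mod_cast Nat.totient_pos.mpr (Nat.pos_of_ne_zero hP)
    have hφaP : (0 : ℝ) < Nat.totient (f a * ∏ i ∈ s, f i) := by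
      exact_mod_cast Nat.totient_pos.mpr (Nat.pos_of_ne_zero (Nat.mul_ne_zero hfa hP))
    have hsuper : (Nat.totient (f a) : ℝ) * Nat.totient (∏ i ∈ s, f i) ≤
        Nat.totient (f a * ∏ i ∈ s, f i) := by
      exact_mod_cast Nat.totient_super_multiplicative _ _
    calc ((f a * ∏ i ∈ s, f i : ℕ) : ℝ) / Nat.totient (f a * ∏ i ∈ s, f i)
        ≤ ((f a * ∏ i ∈ s, f i : ℕ) : ℝ) / (Nat.totient (f a) * Nat.totient (∏ i ∈ s, f i)) :=
          div_le_div_of_nonneg_left (by positivity) (by positivity) hsuper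
      _ = ((f a : ℝ) / Nat.totient (f a)) * (((∏ i ∈ s, f i : ℕ) : ℝ) / Nat.totient (∏ i ∈ s, f i)) := by
          push_cast
          rw [div_mul_div_comm]
      _ ≤ ((f a : ℝ) / Nat.totient (f a)) * ∏ i ∈ s, ((f i : ℝ) / Nat.totient (f i)) :=
          mul_le_mul_of_nonneg_left (ih hfs) (by positivity)

/-! ### Prime powers of small primes, and the support of `Λ`-products -/

/-- There are at most `M (log₂ N + 1)` prime powers `p^e < N` (`e ≥ 1`) with `p < M`. [folklore] -/
theorem card_smallPrimePowers_le (M N : ℕ) :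
    #((Finset.range N).filter fun u =>
        ∃ p ∈ Nat.primesBelow M, ∃ e ∈ Finset.range N, 0 < e ∧ p ^ e = u) ≤
      M * (Nat.log 2 N + 1) := by
  classical
  have hsub : ((Finset.range N).filter fun u =>
      ∃ p ∈ Nat.primesBelow M, ∃ e ∈ Finset.range N, 0 < e ∧ p ^ e = u) ⊆
      (Nat.primesBelow M ×ˢ Finset.range (Nat.log 2 N + 1)).image fun x => x.1 ^ x.2 := by
    intro u hu
    rw [Finset.mem_filter, Finset.mem_range] at hu
    obtain ⟨huN, p, hp, e, -, he, rfl⟩ := hu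
    rw [Finset.mem_image]
    refine ⟨(p, e), Finset.mem_product.mpr ⟨hp, Finset.mem_range.mpr (Nat.lt_succ_of_le ?_)⟩, rfl⟩
    have hp2 : 2 ≤ p := (Nat.mem_primesBelow.mp hp).2.two_le
    exact Nat.le_log_of_pow_le one_lt_two ((Nat.pow_le_pow_left hp2 e).trans huN.le)
  have hπ : #(Nat.primesBelow M) ≤ M := by
    calc #(Nat.primesBelow M) ≤ #(Finset.range M) :=
          Finset.card_le_card fun p hp => Finset.mem_range.mpr (Nat.mem_primesBelow.mp hp).1
      _ = M := Finset.card_range M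
  calc #((Finset.range N).filter fun u =>
        ∃ p ∈ Nat.primesBelow M, ∃ e ∈ Finset.range N, 0 < e ∧ p ^ e = u)
      ≤ #((Nat.primesBelow M ×ˢ Finset.range (Nat.log 2 N + 1)).image fun x => x.1 ^ x.2) :=
        Finset.card_le_card hsub
    _ ≤ #(Nat.primesBelow M ×ˢ Finset.range (Nat.log 2 N + 1)) := Finset.card_image_le
    _ = #(Nat.primesBelow M) * (Nat.log 2 N + 1) := by
        rw [Finset.card_product, Finset.card_range]
    _ ≤ M * (Nat.log 2 N + 1) := Nat.mul_le_mul_right _ hπ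

/-- If `Λ(u) ≠ 0` and a prime `p` divides `u`, then `u` is a power of `p`. [folklore] -/
theorem eq_prime_pow_of_dvd {p u : ℕ} (hp : p.Prime) (hpu : p ∣ u) (hΛ : Λ u ≠ 0) :
    ∃ e : ℕ, 0 < e ∧ p ^ e = u := by
  obtain ⟨q, e, hq, he, rfl⟩ :=
    (isPrimePow_nat_iff _).mp (ArithmeticFunction.vonMangoldt_ne_zero_iff.mp hΛ)
  obtain rfl : p = q := (Nat.prime_dvd_prime_iff_eq hp hq).mp (hp.dvd_of_dvd_pow hpu)
  exact ⟨e, he, rfl⟩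

/-- `∏_{s ∈ T} Λ(n + s) ≤ (log(2Y + 3))^{#T}` for `1 ≤ n ≤ Y` and shifts `s ≤ Y`. [folklore] -/
theorem prod_vonMangoldt_shift_le {Y : ℕ} {T : Finset ℕ} (hT : ∀ s ∈ T, s ≤ Y) {n : ℕ}
    (hn : n ∈ Icc 1 Y) : ∏ s ∈ T, Λ (n + s) ≤ Real.log (2 * Y + 3) ^ #T := by
  rw [← Finset.prod_const]
  refine Finset.prod_le_prod (fun s _ => ArithmeticFunction.vonMangoldt_nonneg) (fun s hs => ?_)
  rw [Finset.mem_Icc] at hn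
  have h1 : (0 : ℝ) < ((n + s : ℕ) : ℝ) := by exact_mod_cast (show 0 < n + s by omega)
  have h2 : ((n + s : ℕ) : ℝ) ≤ 2 * Y + 3 := by
    have := hT s hs
    exact_mod_cast (show n + s ≤ 2 * Y + 3 by omega)
  exact ArithmeticFunction.vonMangoldt_le_log.trans (Real.log_le_log h1 h2)

/-- **The exceptional `n` are few.**  The `1 ≤ n ≤ Y` for which some `n + s` (`s ∈ T`) has a
prime factor `p < M` contribute at most `(log(2Y+3))^{#T} · #T · M (log₂(2Y+3) + 1)` to
`∑ ∏_{s ∈ T} Λ(n+s)`: on the support each such `n + s` is a power of a prime `< M`. [folklore] -/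
theorem sum_filter_prod_vonMangoldt_le {Y M : ℕ} {T : Finset ℕ} (hT : ∀ s ∈ T, s ≤ Y) :
    ∑ n ∈ (Icc 1 Y).filter (fun n => ∃ s ∈ T, ∃ p ∈ Nat.primesBelow M, p ∣ n + s),
        ∏ s ∈ T, Λ (n + s) ≤
      Real.log (2 * Y + 3) ^ #T * (#T * (M * (Nat.log 2 (2 * Y + 3) + 1)) : ℕ) := by
  classical
  set N : ℕ := 2 * Y + 3 with hN
  set PP : Finset ℕ := (Finset.range N).filter fun u =>
    ∃ p ∈ Nat.primesBelow M, ∃ e ∈ Finset.range N, 0 < e ∧ p ^ e = u with hPP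
  set Bad : Finset ℕ := (Icc 1 Y).filter (fun n => ∃ s ∈ T, ∃ p ∈ Nat.primesBelow M, p ∣ n + s)
    with hBad
  have hsub : Bad.filter (fun n => ∏ s ∈ T, Λ (n + s) ≠ 0) ⊆
      T.biUnion fun s => (Icc 1 Y).filter fun n => n + s ∈ PP := by
    intro n hn
    rw [Finset.mem_filter, hBad, Finset.mem_filter] at hn
    obtain ⟨⟨hnY, s, hs, p, hp, hdvd⟩, hF⟩ := hn
    rw [Finset.mem_biUnion]
    refine ⟨s, hs, Finset.mem_filter.mpr ⟨hnY, ?_⟩⟩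
    have hΛ : Λ (n + s) ≠ 0 := fun h0 => hF (Finset.prod_eq_zero hs h0)
    obtain ⟨e, he, hpe⟩ := eq_prime_pow_of_dvd (Nat.mem_primesBelow.mp hp).2 hdvd hΛ
    rw [Finset.mem_Icc] at hnY
    have hsY := hT s hs
    have hltN : n + s < N := by rw [hN]; omega
    have heN : e < N := by
      have h2 : 2 ≤ p := (Nat.mem_primesBelow.mp hp).2.two_le
      calc e < 2 ^ e := Nat.lt_two_pow_self
        _ ≤ p ^ e := Nat.pow_le_pow_left h2 e
        _ = n + s := hpe
        _ < N := hltN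
    rw [hPP, Finset.mem_filter, Finset.mem_range]
    exact ⟨hltN, p, hp, e, Finset.mem_range.mpr heN, he, hpe⟩
  have hcard : #(Bad.filter (fun n => ∏ s ∈ T, Λ (n + s) ≠ 0)) ≤
      #T * (M * (Nat.log 2 N + 1)) := by
    calc #(Bad.filter (fun n => ∏ s ∈ T, Λ (n + s) ≠ 0))
        ≤ #(T.biUnion fun s => (Icc 1 Y).filter fun n => n + s ∈ PP) := Finset.card_le_card hsub
      _ ≤ ∑ s ∈ T, #((Icc 1 Y).filter fun n => n + s ∈ PP) := Finset.card_biUnion_le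
      _ ≤ ∑ s ∈ T, #PP := by
          refine Finset.sum_le_sum fun s _ => ?_
          refine Finset.card_le_card_of_injOn (· + s) ?_ ?_
          · intro n hn
            exact (Finset.mem_filter.mp (Finset.mem_coe.mp hn)).2
          · intro a _ b _ hab
            exact Nat.add_right_cancel hab
      _ = #T * #PP := by rw [Finset.sum_const, smul_eq_mul]
      _ ≤ #T * (M * (Nat.log 2 N + 1)) := Nat.mul_le_mul_left _ (card_smallPrimePowers_le M N)
  have hL0 : 0 ≤ Real.log (2 * Y + 3) := Real.log_nonneg (by
    have : (0 : ℝ) ≤ Y := Nat.cast_nonneg _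
    linarith)
  calc ∑ n ∈ Bad, ∏ s ∈ T, Λ (n + s)
      = ∑ n ∈ Bad.filter (fun n => ∏ s ∈ T, Λ (n + s) ≠ 0), ∏ s ∈ T, Λ (n + s) :=
        (Finset.sum_filter_ne_zero _).symm
    _ ≤ ∑ n ∈ Bad.filter (fun n => ∏ s ∈ T, Λ (n + s) ≠ 0), Real.log (2 * Y + 3) ^ #T := by
        refine Finset.sum_le_sum fun n hn => prod_vonMangoldt_shift_le hT ?_
        have h1 := (Finset.mem_filter.mp hn).1
        rw [hBad, Finset.mem_filter] at h1
        exact h1.1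
    _ = #(Bad.filter (fun n => ∏ s ∈ T, Λ (n + s) ≠ 0)) * Real.log (2 * Y + 3) ^ #T := by
        rw [Finset.sum_const, nsmul_eq_mul]
    _ ≤ ((#T * (M * (Nat.log 2 N + 1)) : ℕ) : ℝ) * Real.log (2 * Y + 3) ^ #T := by
        refine mul_le_mul_of_nonneg_right ?_ (pow_nonneg hL0 _)
        exact_mod_cast hcard
    _ = _ := by rw [hN, mul_comm]

/-! ### Constants -/

/-- The sifting threshold `m = ⌊Y^{1/4}⌋ + 2`: `log(2Y + 3) ≤ 8 log m` for `Y ≥ 1`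
(`4 log m ≥ 4 log 2 = log 16 ≥ log 5` and `4 log m ≥ log Y`). [folklore] -/
theorem log_le_eight_mul_log_threshold {Y : ℕ} (hY : 1 ≤ Y) :
    Real.log (2 * Y + 3) ≤ 8 * Real.log ((⌊((Y : ℝ)) ^ (1 / 4 : ℝ)⌋₊ + 2 : ℕ) : ℝ) := by
  have hY1 : (1 : ℝ) ≤ Y := by exact_mod_cast hY
  have hY0 : (0 : ℝ) < Y := by linarith
  set t : ℝ := ((Y : ℝ)) ^ (1 / 4 : ℝ) with ht
  have ht1 : 1 ≤ t := Real.one_le_rpow hY1 (by norm_num)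
  set m : ℕ := ⌊t⌋₊ + 2 with hm
  have hm2 : (2 : ℝ) ≤ m := by rw [hm]; push_cast; linarith [(Nat.cast_nonneg ⌊t⌋₊ : (0:ℝ) ≤ ⌊t⌋₊)]
  have hmt : t ≤ m := by
    rw [hm]; push_cast
    linarith [(Nat.lt_floor_add_one t).le]
  have hlogm2 : Real.log 2 ≤ Real.log m := Real.log_le_log (by norm_num) hm2
  have hlogmt : Real.log t ≤ Real.log m := Real.log_le_log (by linarith) hmt
  have hlogt : Real.log t = (1 / 4) * Real.log Y := by
    rw [ht, Real.log_rpow hY0]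
  have h16 : Real.log 16 = 4 * Real.log 2 := by
    rw [show (16 : ℝ) = 2 ^ 4 by norm_num, Real.log_pow]; push_cast; ring
  have h5 : Real.log 5 ≤ Real.log 16 := Real.log_le_log (by norm_num) (by norm_num)
  have hlog5Y : Real.log (2 * Y + 3) ≤ Real.log 5 + Real.log Y := by
    rw [← Real.log_mul (by norm_num) hY0.ne']
    exact Real.log_le_log (by linarith) (by linarith)
  linarith

/-- The threshold is `≤ 4 Y^{1/4}` (with `+1`): `⌊Y^{1/4}⌋ + 3 ≤ 4 Y^{1/4}` for `Y ≥ 1`.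
[folklore] -/
theorem threshold_le {Y : ℕ} (hY : 1 ≤ Y) :
    ((⌊((Y : ℝ)) ^ (1 / 4 : ℝ)⌋₊ + 2 + 1 : ℕ) : ℝ) ≤ 4 * ((Y : ℝ)) ^ (1 / 4 : ℝ) := by
  have hY1 : (1 : ℝ) ≤ Y := by exact_mod_cast hY
  have ht1 : 1 ≤ ((Y : ℝ)) ^ (1 / 4 : ℝ) := Real.one_le_rpow hY1 (by norm_num)
  have hfl : (⌊((Y : ℝ)) ^ (1 / 4 : ℝ)⌋₊ : ℝ) ≤ ((Y : ℝ)) ^ (1 / 4 : ℝ) :=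
    Nat.floor_le (by linarith)
  push_cast
  linarith

/-- Powers of `log(2Y + 3)` against `Y^{1/4}`: for every `k` there is `K` with
`(log(2Y+3))^{k+1} ≤ K Y^{1/4}` for all `Y ≥ 1` (`log x ≤ x^ε/ε`). [folklore] -/
theorem exists_log_pow_le_rpow (k : ℕ) : ∃ K : ℝ, 0 < K ∧ ∀ Y : ℕ, 1 ≤ Y →
    Real.log (2 * Y + 3) ^ (k + 1) ≤ K * ((Y : ℝ)) ^ (1 / 4 : ℝ) := by
  set ε : ℝ := 1 / (4 * (k + 1)) with hε
  have hε0 : 0 < ε := by rw [hε]; positivity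
  refine ⟨(5 : ℝ) ^ (1 / 4 : ℝ) / ε ^ (k + 1), by positivity, fun Y hY => ?_⟩
  have hY1 : (1 : ℝ) ≤ Y := by exact_mod_cast hY
  have hY0 : (0 : ℝ) < Y := by linarith
  have h5Y : (2 * Y + 3 : ℝ) ≤ 5 * Y := by linarith
  have hlog0 : 0 ≤ Real.log (2 * Y + 3) := Real.log_nonneg (by linarith)
  have hlog : Real.log (2 * Y + 3) ≤ (5 * Y : ℝ) ^ ε / ε := by
    calc Real.log (2 * Y + 3) ≤ Real.log (5 * Y) := Real.log_le_log (by linarith) h5Y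
      _ ≤ (5 * Y : ℝ) ^ ε / ε := Real.log_le_rpow_div (by linarith) hε0
  calc Real.log (2 * Y + 3) ^ (k + 1) ≤ ((5 * Y : ℝ) ^ ε / ε) ^ (k + 1) :=
        pow_le_pow_left₀ hlog0 hlog _
    _ = (5 * Y : ℝ) ^ (1 / 4 : ℝ) / ε ^ (k + 1) := by
        rw [div_pow, ← Real.rpow_natCast ((5 * Y : ℝ) ^ ε) (k + 1), ← Real.rpow_mul (by linarith)]
        congr 2
        rw [hε]; push_cast; field_simp
    _ = (5 : ℝ) ^ (1 / 4 : ℝ) / ε ^ (k + 1) * ((Y : ℝ)) ^ (1 / 4 : ℝ) := by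
        rw [Real.mul_rpow (by norm_num) hY0.le]; ring

/-! ### The sifted count without partial shift -/

/-- The case without a partially sifted shift of `card_sifted_le`:
`#{1 ≤ n ≤ X : p ∤ n + a for all a ∈ A, p < M} ≤ C X ∏_{p<M} (1 − ν_p(A)/p) + M²` whenever the
classes of `A` do not exhaust `ℤ/p` for any prime `p < M`.
[cite: LichtmanTeravainen2022, Lemma 2.3] -/
theorem card_sifted_le' (D : ℕ) : ∃ C : ℝ, 0 < C ∧
    ∀ (X M : ℕ) (A : Finset ℕ), #A + 1 ≤ D → 2 ≤ M →
      (∀ p ∈ Nat.primesBelow M, #(A.image fun a => (p - a % p) % p) < p) →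
      (#{n ∈ Icc 1 X | ∀ a ∈ A, ∀ p ∈ Nat.primesBelow M, ¬ p ∣ n + a} : ℝ) ≤
        C * X * ∏ p ∈ Nat.primesBelow M, (1 - (#(A.image fun a => (p - a % p) % p) : ℝ) / p) +
          (M : ℝ) ^ 2 := by
  obtain ⟨C, hC, hcore⟩ := card_sifted_le D
  refine ⟨C, hC, fun X M A hD hM hadm => ?_⟩
  have hif : ∀ p ∈ Nat.primesBelow M, ¬ ((1 : ℝ) ≤ (p : ℝ) ∧ (p : ℝ) ≤ 0) := by
    intro p hp h
    have : (0 : ℝ) < p := by exact_mod_cast (Nat.mem_primesBelow.mp hp).2.pos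
    linarith [h.2]
  have hadm' : ∀ p ∈ Nat.primesBelow M,
      #((if (1 : ℝ) ≤ (p : ℝ) ∧ (p : ℝ) ≤ 0 then insert 0 A else A).image
        fun a => (p - a % p) % p) < p := by
    intro p hp
    rw [if_neg (hif p hp)]
    exact hadm p hp
  have h := hcore X M A 0 1 0 hD hM hadm'
  have hprod : ∏ p ∈ Nat.primesBelow M,
      (1 - (#((if (1 : ℝ) ≤ (p : ℝ) ∧ (p : ℝ) ≤ 0 then insert 0 A else A).image
        fun a => (p - a % p) % p) : ℝ) / p) =
      ∏ p ∈ Nat.primesBelow M, (1 - (#(A.image fun a => (p - a % p) % p) : ℝ) / p) :=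
    Finset.prod_congr rfl fun p hp => by rw [if_neg (hif p hp)]
  rw [hprod] at h
  refine le_trans ?_ h
  have hsub : {n ∈ Icc 1 X | ∀ a ∈ A, ∀ p ∈ Nat.primesBelow M, ¬ p ∣ n + a} ⊆
      {n ∈ Icc 1 X | (∀ a ∈ A, ∀ p ∈ Nat.primesBelow M, ¬ p ∣ n + a) ∧
        ∀ p ∈ Nat.primesBelow M, (1 : ℝ) ≤ (p : ℝ) → (p : ℝ) ≤ 0 → ¬ p ∣ n + 0} := by
    intro n hn
    rw [Finset.mem_filter] at hn ⊢
    exact ⟨hn.1, hn.2, fun p hp h1 h2 _ => hif p hp ⟨h1, h2⟩⟩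
  exact_mod_cast Finset.card_le_card hsub

/-- If the classes of `A` exhaust `ℤ/p` for some prime `p < M`, nothing survives the sifting.
[folklore] -/
theorem filter_sifted_eq_empty {X M : ℕ} {A : Finset ℕ} {p : ℕ} (hp : p ∈ Nat.primesBelow M)
    (hfull : p ≤ #(A.image fun a => (p - a % p) % p)) :
    {n ∈ Icc 1 X | ∀ a ∈ A, ∀ p ∈ Nat.primesBelow M, ¬ p ∣ n + a} = ∅ := by
  have hpp : p.Prime := (Nat.mem_primesBelow.mp hp).2
  have hsub : A.image (fun a => (p - a % p) % p) ⊆ Finset.range p := fun r hr =>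
    Finset.mem_range.mpr (image_neg_lt hpp.pos A r hr)
  have heq : A.image (fun a => (p - a % p) % p) = Finset.range p :=
    Finset.eq_of_subset_of_card_le hsub (by rw [Finset.card_range]; exact hfull)
  refine Finset.filter_false_of_mem fun n _ hgood => ?_
  have hmem : n % p ∈ A.image (fun a => (p - a % p) % p) := by
    rw [heq, Finset.mem_range]; exact Nat.mod_lt _ hpp.pos
  obtain ⟨a, ha, hdvd⟩ := (mod_mem_image_neg_iff hpp.pos A n).mp hmem
  exact hgood a ha p hp hdvd

/-! ### Lemma 2.3: the upper bound for tuples of primes, `Λ`-weighted -/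

/-- `log₂ N + 1 ≤ 3 log N` (natural logarithm base `2` against the real logarithm), `N ≥ 3`.
[folklore] -/
theorem natLog_two_add_one_le {N : ℕ} (hN : 3 ≤ N) :
    ((Nat.log 2 N + 1 : ℕ) : ℝ) ≤ 3 * Real.log N := by
  have hN0 : N ≠ 0 := by omega
  have hpow : ((2 ^ Nat.log 2 N : ℕ) : ℝ) ≤ N := by exact_mod_cast Nat.pow_log_le_self 2 hN0
  have hlog2 : (0.6931471803 : ℝ) < Real.log 2 := Real.log_two_gt_d9
  have h1 : (Nat.log 2 N : ℝ) * Real.log 2 ≤ Real.log N := by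
    have := Real.log_le_log (by positivity) hpow
    push_cast at this
    rwa [Real.log_pow] at this
  have hN3 : Real.log 3 ≤ Real.log N := Real.log_le_log (by norm_num) (by exact_mod_cast hN)
  have h3 : (1.0397 : ℝ) < Real.log 3 := by
    have h9 : Real.log 3 = Real.log 9 / 2 := by
      rw [show (9 : ℝ) = 3 ^ 2 by norm_num, Real.log_pow]; push_cast; ring
    have h8 : Real.log 8 < Real.log 9 := Real.log_lt_log (by norm_num) (by norm_num)
    have h8' : Real.log 8 = 3 * Real.log 2 := by
      rw [show (8 : ℝ) = 2 ^ 3 by norm_num, Real.log_pow]; push_cast; ring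
    linarith
  have ha0 : (0 : ℝ) ≤ (Nat.log 2 N : ℕ) := Nat.cast_nonneg _
  have h2 : ((Nat.log 2 N : ℕ) : ℝ) * 0.6931471803 ≤ Real.log N :=
    le_trans (mul_le_mul_of_nonneg_left hlog2.le ha0) h1
  push_cast
  linarith

set_option maxHeartbeats 1000000 in
/-- **Lichtman–Teräväinen, Lemma 2.3 (Selberg's upper bound for prime tuples), `Λ`-weighted and
uniform in the shifts.**  For every `k` there is `C = C(k)` such that for all `Y` and all sets `T`
of at most `k` shifts `s ≤ Y`,
`∑_{n ≤ Y} ∏_{s ∈ T} Λ(n + s) ≤ C (Y · (∏_{s ≠ s' ∈ T} |s − s'|/φ(|s − s'|))^k + Y^{3/4})`.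
Printed: "`#{n ≤ X : n + h₁, …, n + h_k ∈ ℙ} ≤ k!·2^k 𝔖(ℋ) X/(log X)^k (1 + O(log log X/log X))`"
[Opera de Cribro] with Lemma 2.4, `𝔖(ℋ) ≪_k ∏_{i<j} (|hᵢ − hⱼ|/φ(|hᵢ − hⱼ|))^k`; here with an
unspecified constant, which is all the paper uses.  Proof: sift `n + s` (`s ∈ T`) by the primes
`≤ m = ⌊Y^{1/4}⌋ + 2` (`card_sifted_le'`, `prod_one_sub_card_image_le`, Mertens), bound each
`Λ ≤ log(2Y+3) ≤ 8 log m`, and count separately the `n` with some `n + s` a power of a prime `≤ m`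
(`sum_filter_prod_vonMangoldt_le`). [cite: LichtmanTeravainen2022, Lemma 2.3 and Lemma 2.4] -/
theorem sum_prod_vonMangoldt_le (k : ℕ) : ∃ C : ℝ, 0 < C ∧ ∀ (Y : ℕ) (T : Finset ℕ),
    #T ≤ k → (∀ s ∈ T, s ≤ Y) →
    ∑ n ∈ Icc 1 Y, ∏ s ∈ T, Λ (n + s) ≤
      C * (Y * (∏ x ∈ T.offDiag, ((((x.1 : ℤ) - x.2).natAbs : ℕ) : ℝ) /
        Nat.totient (((x.1 : ℤ) - x.2).natAbs)) ^ k + ((Y : ℝ)) ^ (3 / 4 : ℝ)) := by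
  classical
  obtain ⟨C₀, hC₀, hcore⟩ := card_sifted_le' (k + 1)
  obtain ⟨K₃, hK₃, hlogpow⟩ := exists_log_pow_le_rpow k
  set E₀ : ℝ := Real.exp (6 / Real.log 2) with hE₀
  set B : ℝ := E₀ * Real.log 2 * 8 with hB
  have hB0 : 0 ≤ B := by rw [hB]; have := Real.log_pos one_lt_two; positivity
  set K₁ : ℝ := max 1 (B ^ k) with hK₁
  have hK₁1 : 1 ≤ K₁ := le_max_left _ _
  refine ⟨C₀ * K₁ + 16 * K₃ + 12 * (k + 1) * K₃, by positivity, ?_⟩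
  intro Y T hTk hTY
  set Spair : ℝ := ∏ x ∈ T.offDiag, ((((x.1 : ℤ) - x.2).natAbs : ℕ) : ℝ) /
    Nat.totient (((x.1 : ℤ) - x.2).natAbs) with hSpair
  -- the pair factor is `≥ 1`
  have hd0 : ∀ x ∈ T.offDiag, ((x.1 : ℤ) - x.2).natAbs ≠ 0 := by
    intro x hx
    rw [Finset.mem_offDiag] at hx
    rw [Ne, Int.natAbs_eq_zero, sub_eq_zero, Nat.cast_inj]
    exact hx.2.2
  have hS1 : 1 ≤ Spair := by
    rw [hSpair, ← Finset.prod_const_one (s := T.offDiag)]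
    refine Finset.prod_le_prod (fun _ _ => zero_le_one) fun x hx => ?_
    rw [le_div_iff₀ (by exact_mod_cast Nat.totient_pos.mpr (Nat.pos_of_ne_zero (hd0 x hx))), one_mul]
    exact_mod_cast Nat.totient_le _
  -- `Y = 0`
  rcases Nat.eq_zero_or_pos Y with rfl | hYpos
  · have : ∑ n ∈ Icc 1 0, ∏ s ∈ T, Λ (n + s) = 0 := by simp
    rw [this]
    positivity
  have hY : 1 ≤ Y := hYpos
  have hY1 : (1 : ℝ) ≤ Y := by exact_mod_cast hY
  have hY0 : (0 : ℝ) < Y := by linarith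
  -- parameters
  set t : ℝ := ((Y : ℝ)) ^ (1 / 4 : ℝ) with ht
  have ht1 : 1 ≤ t := Real.one_le_rpow hY1 (by norm_num)
  set m : ℕ := ⌊t⌋₊ + 2 with hm
  set M : ℕ := m + 1 with hM
  have hm2 : 2 ≤ m := by rw [hm]; omega
  have hM2 : 2 ≤ M := by rw [hM]; omega
  have hMt : (M : ℝ) ≤ 4 * t := threshold_le hY
  have hM0 : (0 : ℝ) ≤ M := Nat.cast_nonneg _
  set L : ℝ := Real.log (2 * Y + 3) with hL
  have hL8 : L ≤ 8 * Real.log m := log_le_eight_mul_log_threshold hY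
  have hlogm : 0 < Real.log m := Real.log_pos (by exact_mod_cast (show 1 < m by omega))
  have hL1 : 1 ≤ L := by
    rw [hL]
    rw [← Real.log_exp 1]
    refine Real.log_le_log (Real.exp_pos 1) ?_
    have := Real.exp_one_lt_d9
    linarith
  have hL0 : 0 ≤ L := by linarith
  have hLK : L ^ (k + 1) ≤ K₃ * t := hlogpow Y hY
  set j : ℕ := #T with hj
  have hjk : j ≤ k := hTk
  -- split into sifted and exceptional `n`
  set good : ℕ → Prop := fun n => ∀ s ∈ T, ∀ p ∈ Nat.primesBelow M, ¬ p ∣ n + s with hgood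
  have hsplit := (Finset.sum_filter_add_sum_filter_not (Icc 1 Y) good
    (fun n => ∏ s ∈ T, Λ (n + s))).symm
  -- exceptional part
  have hbad : ∑ n ∈ (Icc 1 Y).filter (fun n => ¬ good n), ∏ s ∈ T, Λ (n + s) ≤
      L ^ j * ((j * (M * (Nat.log 2 (2 * Y + 3) + 1)) : ℕ) : ℝ) := by
    have heq : (Icc 1 Y).filter (fun n => ¬ good n) =
        (Icc 1 Y).filter (fun n => ∃ s ∈ T, ∃ p ∈ Nat.primesBelow M, p ∣ n + s) := by
      refine Finset.filter_congr fun n _ => ?_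
      simp only [hgood]
      push Not
      rfl
    rw [heq]
    exact sum_filter_prod_vonMangoldt_le hTY
  -- sifted part
  have hF0 : ∀ n, 0 ≤ ∏ s ∈ T, Λ (n + s) := fun n =>
    Finset.prod_nonneg fun s _ => ArithmeticFunction.vonMangoldt_nonneg
  have hgood1 : ∑ n ∈ (Icc 1 Y).filter good, ∏ s ∈ T, Λ (n + s) ≤
      #((Icc 1 Y).filter good) * L ^ j := by
    have h1 : ∀ n ∈ (Icc 1 Y).filter good, ∏ s ∈ T, Λ (n + s) ≤ L ^ j := fun n hn =>
      prod_vonMangoldt_shift_le hTY (Finset.mem_filter.mp hn).1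
    calc ∑ n ∈ (Icc 1 Y).filter good, ∏ s ∈ T, Λ (n + s)
        ≤ ∑ n ∈ (Icc 1 Y).filter good, L ^ j := Finset.sum_le_sum h1
      _ = #((Icc 1 Y).filter good) * L ^ j := by rw [Finset.sum_const, nsmul_eq_mul]
  -- Mertens
  set W : ℝ := ∏ p ∈ Nat.primesBelow M, (1 - 1 / (p : ℝ)) with hW
  have hW0 : 0 ≤ W := Finset.prod_nonneg fun p hp => by
    have h2 : (2 : ℝ) ≤ p := by exact_mod_cast (Nat.mem_primesBelow.mp hp).2.two_le
    have : 1 / (p : ℝ) ≤ 1 / 2 := one_div_le_one_div_of_le (by norm_num) h2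
    linarith
  have hWle : W ≤ E₀ * (Real.log 2 / Real.log m) := by
    have := prod_primesLE_one_sub_inv_le hm2
    exact this
  have hWL : W * L ≤ B := by
    calc W * L ≤ E₀ * (Real.log 2 / Real.log m) * (8 * Real.log m) :=
          mul_le_mul hWle hL8 hL0 (by positivity)
      _ = B := by rw [hB]; field_simp
  set Δ : ℕ := ∏ x ∈ T.offDiag, ((x.1 : ℤ) - x.2).natAbs with hΔ
  have hΔS : (Δ : ℝ) / Nat.totient Δ ≤ Spair := by
    have := cast_prod_div_totient_le T.offDiag (fun x => ((x.1 : ℤ) - x.2).natAbs) hd0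
    simpa only [hΔ, hSpair] using this
  have hΔ0 : (0 : ℝ) ≤ (Δ : ℝ) / Nat.totient Δ := by positivity
  -- the sifted count
  have hgood2 : (#((Icc 1 Y).filter good) : ℝ) ≤ C₀ * Y * (W ^ j * ((Δ : ℝ) / Nat.totient Δ) ^ j) +
      (M : ℝ) ^ 2 := by
    by_cases hadm : ∀ p ∈ Nat.primesBelow M, #(T.image fun a => (p - a % p) % p) < p
    · have h1 := hcore Y M T (by omega) hM2 hadm
      have h2 := prod_one_sub_card_image_le T M
      calc (#((Icc 1 Y).filter good) : ℝ)
          ≤ C₀ * Y * ∏ p ∈ Nat.primesBelow M,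
              (1 - (#(T.image fun a => (p - a % p) % p) : ℝ) / p) + (M : ℝ) ^ 2 := h1
        _ ≤ C₀ * Y * (W ^ j * ((Δ : ℝ) / Nat.totient Δ) ^ j) + (M : ℝ) ^ 2 := by
            have := mul_le_mul_of_nonneg_left h2 (by positivity : 0 ≤ C₀ * (Y : ℝ))
            linarith
    · push Not at hadm
      obtain ⟨p, hp, hfull⟩ := hadm
      rw [filter_sifted_eq_empty hp hfull, Finset.card_empty, Nat.cast_zero]
      positivity
  -- assemble
  have hN3 : 3 ≤ 2 * Y + 3 := by omega
  have hlogN := natLog_two_add_one_le hN3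
  have hLj : L ^ j ≤ L ^ k := pow_le_pow_right₀ hL1 hjk
  have hLj1 : L ^ j ≤ L ^ (k + 1) := pow_le_pow_right₀ hL1 (by omega)
  have hjR : (j : ℝ) ≤ k := by exact_mod_cast hjk
  -- term A
  have hA : C₀ * Y * (W ^ j * ((Δ : ℝ) / Nat.totient Δ) ^ j) * L ^ j ≤
      C₀ * K₁ * (Y * Spair ^ k) := by
    have e1 : W ^ j * L ^ j ≤ K₁ := by
      rw [← mul_pow]
      have hWL0 : 0 ≤ W * L := mul_nonneg hW0 hL0
      have hmax : (W * L) ^ j ≤ max 1 ((W * L) ^ k) := by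
        rcases le_or_gt 1 (W * L) with h1 | h1
        · exact (pow_le_pow_right₀ h1 hjk).trans (le_max_right _ _)
        · exact (pow_le_one₀ hWL0 h1.le).trans (le_max_left _ _)
      exact hmax.trans (max_le_max le_rfl (pow_le_pow_left₀ hWL0 hWL k))
    have e2 : ((Δ : ℝ) / Nat.totient Δ) ^ j ≤ Spair ^ k :=
      (pow_le_pow_left₀ hΔ0 hΔS j).trans (pow_le_pow_right₀ hS1 hjk)
    calc C₀ * Y * (W ^ j * ((Δ : ℝ) / Nat.totient Δ) ^ j) * L ^ j
        = C₀ * Y * ((W ^ j * L ^ j) * ((Δ : ℝ) / Nat.totient Δ) ^ j) := by ring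
      _ ≤ C₀ * Y * (K₁ * Spair ^ k) := by
          refine mul_le_mul_of_nonneg_left ?_ (by positivity)
          exact mul_le_mul e1 e2 (by positivity) (by positivity)
      _ = C₀ * K₁ * (Y * Spair ^ k) := by ring
  -- `t³ = Y^{3/4}`
  have ht3 : t ^ 3 = ((Y : ℝ)) ^ (3 / 4 : ℝ) := by
    rw [ht, ← Real.rpow_natCast, ← Real.rpow_mul hY0.le]; norm_num
  have ht0 : 0 ≤ t := by linarith
  -- term B
  have hBt : (M : ℝ) ^ 2 * L ^ j ≤ 16 * K₃ * t ^ 3 := by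
    calc (M : ℝ) ^ 2 * L ^ j ≤ (4 * t) ^ 2 * (K₃ * t) :=
          mul_le_mul (pow_le_pow_left₀ hM0 hMt 2) (hLj1.trans hLK) (pow_nonneg hL0 _) (by positivity)
      _ = 16 * K₃ * t ^ 3 := by ring
  -- term C
  have hCt : L ^ j * ((j * (M * (Nat.log 2 (2 * Y + 3) + 1)) : ℕ) : ℝ) ≤ 12 * (k + 1) * K₃ * t ^ 3 := by
    have e1 : ((j * (M * (Nat.log 2 (2 * Y + 3) + 1)) : ℕ) : ℝ) ≤ k * ((4 * t) * (3 * L)) := by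
      push_cast
      have hlogN' : ((Nat.log 2 (2 * Y + 3) : ℕ) : ℝ) + 1 ≤ 3 * L := by
        have := hlogN; push_cast at this; rw [hL]; linarith
      have : (M : ℝ) * (((Nat.log 2 (2 * Y + 3) : ℕ) : ℝ) + 1) ≤ (4 * t) * (3 * L) :=
        mul_le_mul hMt hlogN' (by positivity) (by positivity)
      calc (j : ℝ) * ((M : ℝ) * ((Nat.log 2 (2 * Y + 3) : ℕ) + 1)) ≤ k * ((4 * t) * (3 * L)) :=
            mul_le_mul hjR this (by positivity) (by positivity)
        _ = _ := by ring
    calc L ^ j * ((j * (M * (Nat.log 2 (2 * Y + 3) + 1)) : ℕ) : ℝ)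
        ≤ L ^ k * (k * ((4 * t) * (3 * L))) := mul_le_mul hLj e1 (by positivity) (pow_nonneg hL0 _)
      _ = 12 * k * t * L ^ (k + 1) := by ring
      _ ≤ 12 * k * t * (K₃ * t) := mul_le_mul_of_nonneg_left hLK (by positivity)
      _ = 12 * k * K₃ * t ^ 2 := by ring
      _ ≤ 12 * (k + 1) * K₃ * t ^ 3 := by
          have h23 : t ^ 2 ≤ t ^ 3 := by nlinarith [sq_nonneg t]
          have hk : (12 * k * K₃ : ℝ) ≤ 12 * (k + 1) * K₃ := by
            have : (k : ℝ) ≤ k + 1 := by linarith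
            exact mul_le_mul_of_nonneg_right (by linarith) hK₃.le
          exact mul_le_mul hk h23 (pow_nonneg ht0 2) (by positivity)
  -- total
  calc ∑ n ∈ Icc 1 Y, ∏ s ∈ T, Λ (n + s)
      = ∑ n ∈ (Icc 1 Y).filter good, ∏ s ∈ T, Λ (n + s) +
          ∑ n ∈ (Icc 1 Y).filter (fun n => ¬ good n), ∏ s ∈ T, Λ (n + s) := hsplit
    _ ≤ #((Icc 1 Y).filter good) * L ^ j +
          L ^ j * ((j * (M * (Nat.log 2 (2 * Y + 3) + 1)) : ℕ) : ℝ) := add_le_add hgood1 hbad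
    _ ≤ (C₀ * Y * (W ^ j * ((Δ : ℝ) / Nat.totient Δ) ^ j) + (M : ℝ) ^ 2) * L ^ j +
          L ^ j * ((j * (M * (Nat.log 2 (2 * Y + 3) + 1)) : ℕ) : ℝ) := by
        gcongr
    _ = C₀ * Y * (W ^ j * ((Δ : ℝ) / Nat.totient Δ) ^ j) * L ^ j + (M : ℝ) ^ 2 * L ^ j +
          L ^ j * ((j * (M * (Nat.log 2 (2 * Y + 3) + 1)) : ℕ) : ℝ) := by ring
    _ ≤ C₀ * K₁ * (Y * Spair ^ k) + 16 * K₃ * t ^ 3 + 12 * (k + 1) * K₃ * t ^ 3 :=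
        add_le_add (add_le_add hA hBt) hCt
    _ ≤ (C₀ * K₁ + 16 * K₃ + 12 * (k + 1) * K₃) * (Y * Spair ^ k + ((Y : ℝ)) ^ (3 / 4 : ℝ)) := by
        rw [ht3]
        have h1 : 0 ≤ (Y : ℝ) * Spair ^ k := by positivity
        have h2 : 0 ≤ ((Y : ℝ)) ^ (3 / 4 : ℝ) := by positivity
        nlinarith [mul_nonneg (by positivity : (0:ℝ) ≤ C₀ * K₁) h2,
          mul_nonneg (by positivity : (0:ℝ) ≤ 16 * K₃ + 12 * (k + 1) * K₃) h1]


/-! ### Lemma 2.11: primes against integers without prime factors in an interval -/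

/-- If the classes of `A` together with `-h` (modulo the primes of `[P, Q]`) exhaust `ℤ/p` for some
prime `p < M`, nothing survives the sifting. [folklore] -/
theorem filter_sifted_eq_empty' {X M : ℕ} {A : Finset ℕ} {h : ℕ} {P Q : ℝ} {p : ℕ}
    (hp : p ∈ Nat.primesBelow M)
    (hfull : p ≤ #((if P ≤ (p : ℝ) ∧ (p : ℝ) ≤ Q then insert h A else A).image
      fun a => (p - a % p) % p)) :
    {n ∈ Icc 1 X | (∀ a ∈ A, ∀ p ∈ Nat.primesBelow M, ¬ p ∣ n + a) ∧
        ∀ p ∈ Nat.primesBelow M, P ≤ (p : ℝ) → (p : ℝ) ≤ Q → ¬ p ∣ n + h} = ∅ := by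
  have hpp : p.Prime := (Nat.mem_primesBelow.mp hp).2
  set A' := (if P ≤ (p : ℝ) ∧ (p : ℝ) ≤ Q then insert h A else A) with hA'
  have hsub : A'.image (fun a => (p - a % p) % p) ⊆ Finset.range p := fun r hr =>
    Finset.mem_range.mpr (image_neg_lt hpp.pos A' r hr)
  have heq : A'.image (fun a => (p - a % p) % p) = Finset.range p :=
    Finset.eq_of_subset_of_card_le hsub (by rw [Finset.card_range]; exact hfull)
  refine Finset.filter_false_of_mem fun n _ hgood => ?_
  have hmem : n % p ∈ A'.image (fun a => (p - a % p) % p) := by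
    rw [heq, Finset.mem_range]; exact Nat.mod_lt _ hpp.pos
  obtain ⟨a, ha, hdvd⟩ := (mod_mem_image_neg_iff hpp.pos A' n).mp hmem
  rw [hA'] at ha
  split_ifs at ha with hPQ
  · rcases Finset.mem_insert.mp ha with rfl | ha'
    · exact hgood.2 p hp hPQ.1 hPQ.2 hdvd
    · exact hgood.1 a ha' p hp hdvd
  · exact hgood.1 a ha p hp hdvd

set_option maxHeartbeats 1000000 in
/-- **Lichtman–Teräväinen, Lemma 2.11, uniform in the shift.**  For every `k` there is
`C = C(k)` such that for all `X`, all sets `A` of at most `k` shifts `a ≤ X`, all `h ∉ A` and all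
`2 ≤ P ≤ Q ≤ X^{1/4}`:
`∑_{n ≤ X} 1[n + h has no prime factor in [P, Q]] ∏_{a ∈ A} Λ(n + a)
   ≤ C (X · (∏_{a≠a'∈A} |a−a'|/φ(|a−a'|))^k · (log P/log Q) · ∏_{a ∈ A} |h−a|/φ(|h−a|) + X^{3/4})`.
Printed (with `𝒩` the integers free of prime factors from `ℐ`):
"`∑_{n ≤ X} 1_𝒩(n+h) Λ(n+a₁)⋯Λ(n+a_ℓ) ≪ X ∏_j (|h−aⱼ|/φ(|h−aⱼ|))^{2^{ℓ+1}} ∏_{p ∈ ℐ} (1 − 1/p)`",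
proved there from Henriot's discriminant-uniform Nair–Tenenbaum bound; here instead from the
upper-bound sieve with one partially sifted shift (`card_sifted_le`, `prod_one_sub_card_le_mul`:
modulo `p ∈ [P, Q]`, `p ∤ ∏ |h − a|`, the class `−h` is new), Mertens over `[P, Q]`
(`Lichtman2020.prod_sieveWeight_le`: `∏ c(p) ≪ (log P/log Q) D_h/φ(D_h)`), with the better
exponent `1` on `|h − a|/φ(|h − a|)` and for `Q ≤ X^{1/4}` (ample for the intervals `[P_j, Q_j]`,
`Q_j ≤ exp(√(log X))`, of the typical factorisations). [cite: LichtmanTeravainen2022, Lemma 2.11] -/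
theorem sum_indicator_prod_vonMangoldt_le (k : ℕ) : ∃ C : ℝ, 0 < C ∧
    ∀ (X : ℕ) (A : Finset ℕ) (h : ℕ) (P Q : ℝ), #A ≤ k → (∀ a ∈ A, a ≤ X) → h ∉ A →
      2 ≤ P → P ≤ Q → Q ≤ ((X : ℝ)) ^ (1 / 4 : ℝ) →
      ∑ n ∈ Icc 1 X, (if HasPrimeFactorIn P Q (n + h) then 0 else ∏ a ∈ A, Λ (n + a)) ≤
        C * (X * (∏ x ∈ A.offDiag, ((((x.1 : ℤ) - x.2).natAbs : ℕ) : ℝ) /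
              Nat.totient (((x.1 : ℤ) - x.2).natAbs)) ^ k * (Real.log P / Real.log Q) *
              ∏ a ∈ A, (((((h : ℤ) - a).natAbs : ℕ) : ℝ) / Nat.totient (((h : ℤ) - a).natAbs))
          + ((X : ℝ)) ^ (3 / 4 : ℝ)) := by
  classical
  obtain ⟨C₀, hC₀, hcore⟩ := card_sifted_le (k + 1)
  obtain ⟨K₃, hK₃, hlogpow⟩ := exists_log_pow_le_rpow k
  set E₀ : ℝ := Real.exp (6 / Real.log 2) with hE₀
  set B : ℝ := E₀ * Real.log 2 * 8 with hB
  have hB0 : 0 ≤ B := by rw [hB]; have := Real.log_pos one_lt_two; positivity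
  set K₁ : ℝ := max 1 (B ^ k) with hK₁
  have hK₁1 : 1 ≤ K₁ := le_max_left _ _
  refine ⟨C₀ * K₁ * E₀ + 16 * K₃ + 12 * (k + 1) * K₃, by positivity, ?_⟩
  intro X A h P Q hAk hAX hhA hP hPQ hQX
  set Spair : ℝ := ∏ x ∈ A.offDiag, ((((x.1 : ℤ) - x.2).natAbs : ℕ) : ℝ) /
    Nat.totient (((x.1 : ℤ) - x.2).natAbs) with hSpair
  set Dprod : ℝ := ∏ a ∈ A, (((((h : ℤ) - a).natAbs : ℕ) : ℝ) / Nat.totient (((h : ℤ) - a).natAbs))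
    with hDprod
  set D : ℕ := ∏ a ∈ A, ((h : ℤ) - a).natAbs with hD
  have hd0 : ∀ x ∈ A.offDiag, ((x.1 : ℤ) - x.2).natAbs ≠ 0 := by
    intro x hx
    rw [Finset.mem_offDiag] at hx
    rw [Ne, Int.natAbs_eq_zero, sub_eq_zero, Nat.cast_inj]
    exact hx.2.2
  have hda0 : ∀ a ∈ A, ((h : ℤ) - a).natAbs ≠ 0 := by
    intro a ha
    rw [Ne, Int.natAbs_eq_zero, sub_eq_zero, Nat.cast_inj]
    rintro rfl
    exact hhA ha
  have hS1 : 1 ≤ Spair := by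
    rw [hSpair, ← Finset.prod_const_one (s := A.offDiag)]
    refine Finset.prod_le_prod (fun _ _ => zero_le_one) fun x hx => ?_
    rw [le_div_iff₀ (by exact_mod_cast Nat.totient_pos.mpr (Nat.pos_of_ne_zero (hd0 x hx))), one_mul]
    exact_mod_cast Nat.totient_le _
  have hDp1 : 1 ≤ Dprod := by
    rw [hDprod, ← Finset.prod_const_one (s := A)]
    refine Finset.prod_le_prod (fun _ _ => zero_le_one) fun a ha => ?_
    rw [le_div_iff₀ (by exact_mod_cast Nat.totient_pos.mpr (Nat.pos_of_ne_zero (hda0 a ha))), one_mul]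
    exact_mod_cast Nat.totient_le _
  have hD1 : 1 ≤ D := Nat.pos_of_ne_zero (Finset.prod_ne_zero_iff.mpr hda0)
  have hDle : (D : ℝ) / Nat.totient D ≤ Dprod := by
    have := cast_prod_div_totient_le A (fun a => ((h : ℤ) - a).natAbs) hda0
    simpa only [hD, hDprod] using this
  have hlogP : 0 < Real.log P := Real.log_pos (by linarith)
  have hlogQ : 0 < Real.log Q := Real.log_pos (by linarith)
  have hρ0 : 0 < Real.log P / Real.log Q := div_pos hlogP hlogQ
  -- `X = 0`
  rcases Nat.eq_zero_or_pos X with rfl | hXpos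
  · have : ∑ n ∈ Icc 1 0, (if HasPrimeFactorIn P Q (n + h) then (0 : ℝ) else ∏ a ∈ A, Λ (n + a)) = 0 := by
      simp
    rw [this]
    positivity
  have hX : 1 ≤ X := hXpos
  have hX1 : (1 : ℝ) ≤ X := by exact_mod_cast hX
  have hX0 : (0 : ℝ) < X := by linarith
  -- parameters
  set t : ℝ := ((X : ℝ)) ^ (1 / 4 : ℝ) with ht
  have ht1 : 1 ≤ t := Real.one_le_rpow hX1 (by norm_num)
  set m : ℕ := ⌊t⌋₊ + 2 with hm
  set M : ℕ := m + 1 with hM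
  have hm2 : 2 ≤ m := by rw [hm]; omega
  have hM2 : 2 ≤ M := by rw [hM]; omega
  have hMt : (M : ℝ) ≤ 4 * t := threshold_le hX
  have hM0 : (0 : ℝ) ≤ M := Nat.cast_nonneg _
  have htm : t ≤ m := by
    rw [hm]; push_cast; linarith [(Nat.lt_floor_add_one t).le]
  have hQm : Q ≤ m := hQX.trans htm
  have hPm : P ≤ m := hPQ.trans hQm
  set L : ℝ := Real.log (2 * X + 3) with hL
  have hL8 : L ≤ 8 * Real.log m := log_le_eight_mul_log_threshold hX
  have hlogm : 0 < Real.log m := Real.log_pos (by exact_mod_cast (show 1 < m by omega))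
  have hL1 : 1 ≤ L := by
    rw [hL, ← Real.log_exp 1]
    refine Real.log_le_log (Real.exp_pos 1) ?_
    have := Real.exp_one_lt_d9
    linarith
  have hL0 : 0 ≤ L := by linarith
  have hLK : L ^ (k + 1) ≤ K₃ * t := hlogpow X hX
  set j : ℕ := #A with hj
  have hjk : j ≤ k := hAk
  -- the summand against the plain `Λ`-product
  set F : ℕ → ℝ := fun n => ∏ a ∈ A, Λ (n + a) with hF
  have hF0 : ∀ n, 0 ≤ F n := fun n =>
    Finset.prod_nonneg fun a _ => ArithmeticFunction.vonMangoldt_nonneg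
  have hGF : ∀ n, (if HasPrimeFactorIn P Q (n + h) then (0 : ℝ) else ∏ a ∈ A, Λ (n + a)) ≤ F n := by
    intro n; split_ifs
    · exact hF0 n
    · exact le_rfl
  have hG0 : ∀ n, 0 ≤ (if HasPrimeFactorIn P Q (n + h) then (0 : ℝ) else ∏ a ∈ A, Λ (n + a)) := by
    intro n; split_ifs
    · exact le_rfl
    · exact hF0 n
  -- split into sifted and exceptional `n`
  set good : ℕ → Prop := fun n => (∀ a ∈ A, ∀ p ∈ Nat.primesBelow M, ¬ p ∣ n + a) ∧
    ∀ p ∈ Nat.primesBelow M, P ≤ (p : ℝ) → (p : ℝ) ≤ Q → ¬ p ∣ n + h with hgood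
  set badA : ℕ → Prop := fun n => ∃ a ∈ A, ∃ p ∈ Nat.primesBelow M, p ∣ n + a with hbadA
  have hsplit := (Finset.sum_filter_add_sum_filter_not (Icc 1 X) good
    (fun n => if HasPrimeFactorIn P Q (n + h) then (0 : ℝ) else ∏ a ∈ A, Λ (n + a))).symm
  -- exceptional part: either some `n + a` has a small prime factor, or the indicator vanishes
  have hbad_pt : ∀ n ∈ (Icc 1 X).filter (fun n => ¬ good n),
      (if HasPrimeFactorIn P Q (n + h) then (0 : ℝ) else ∏ a ∈ A, Λ (n + a)) ≤
        if badA n then F n else 0 := by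
    intro n hn
    rw [Finset.mem_filter] at hn
    by_cases hb : badA n
    · rw [if_pos hb]; exact hGF n
    · rw [if_neg hb]
      have hn2 := hn.2
      simp only [hgood, not_and_or] at hn2
      rcases hn2 with h1 | h2
      · exfalso; apply hb
        simp only [hbadA]
        push Not at h1
        exact h1
      · push Not at h2
        obtain ⟨p, hp, hPp, hpQ, hdvd⟩ := h2
        have hpp : p.Prime := (Nat.mem_primesBelow.mp hp).2
        have hnh : n + h ≠ 0 := by have := (Finset.mem_Icc.mp hn.1).1; omega
        have hHPF : HasPrimeFactorIn P Q (n + h) :=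
          ⟨p, Nat.mem_primeFactors.mpr ⟨hpp, hdvd, hnh⟩, hPp, hpQ⟩
        rw [if_pos hHPF]
  have hbad : ∑ n ∈ (Icc 1 X).filter (fun n => ¬ good n),
      (if HasPrimeFactorIn P Q (n + h) then (0 : ℝ) else ∏ a ∈ A, Λ (n + a)) ≤
      L ^ j * ((j * (M * (Nat.log 2 (2 * X + 3) + 1)) : ℕ) : ℝ) := by
    calc ∑ n ∈ (Icc 1 X).filter (fun n => ¬ good n),
          (if HasPrimeFactorIn P Q (n + h) then (0 : ℝ) else ∏ a ∈ A, Λ (n + a))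
        ≤ ∑ n ∈ (Icc 1 X).filter (fun n => ¬ good n), (if badA n then F n else 0) :=
          Finset.sum_le_sum hbad_pt
      _ = ∑ n ∈ ((Icc 1 X).filter (fun n => ¬ good n)).filter badA, F n :=
          (Finset.sum_filter _ _).symm
      _ ≤ ∑ n ∈ (Icc 1 X).filter badA, F n := by
          refine Finset.sum_le_sum_of_subset_of_nonneg ?_ (fun n _ _ => hF0 n)
          intro n hn
          rw [Finset.mem_filter, Finset.mem_filter] at hn
          exact Finset.mem_filter.mpr ⟨hn.1.1, hn.2⟩
      _ ≤ L ^ j * ((j * (M * (Nat.log 2 (2 * X + 3) + 1)) : ℕ) : ℝ) :=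
          sum_filter_prod_vonMangoldt_le hAX
  -- sifted part
  have hgood1 : ∑ n ∈ (Icc 1 X).filter good,
      (if HasPrimeFactorIn P Q (n + h) then (0 : ℝ) else ∏ a ∈ A, Λ (n + a)) ≤
      #((Icc 1 X).filter good) * L ^ j := by
    have h1 : ∀ n ∈ (Icc 1 X).filter good,
        (if HasPrimeFactorIn P Q (n + h) then (0 : ℝ) else ∏ a ∈ A, Λ (n + a)) ≤ L ^ j :=
      fun n hn => (hGF n).trans (prod_vonMangoldt_shift_le hAX (Finset.mem_filter.mp hn).1)
    calc ∑ n ∈ (Icc 1 X).filter good,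
          (if HasPrimeFactorIn P Q (n + h) then (0 : ℝ) else ∏ a ∈ A, Λ (n + a))
        ≤ ∑ n ∈ (Icc 1 X).filter good, L ^ j := Finset.sum_le_sum h1
      _ = #((Icc 1 X).filter good) * L ^ j := by rw [Finset.sum_const, nsmul_eq_mul]
  -- Mertens, twice
  set W : ℝ := ∏ p ∈ Nat.primesBelow M, (1 - 1 / (p : ℝ)) with hW
  have hW0 : 0 ≤ W := Finset.prod_nonneg fun p hp => by
    have h2 : (2 : ℝ) ≤ p := by exact_mod_cast (Nat.mem_primesBelow.mp hp).2.two_le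
    have : 1 / (p : ℝ) ≤ 1 / 2 := one_div_le_one_div_of_le (by norm_num) h2
    linarith
  have hWle : W ≤ E₀ * (Real.log 2 / Real.log m) := by
    have := prod_primesLE_one_sub_inv_le hm2
    exact this
  have hWL : W * L ≤ B := by
    calc W * L ≤ E₀ * (Real.log 2 / Real.log m) * (8 * Real.log m) :=
          mul_le_mul hWle hL8 hL0 (by positivity)
      _ = B := by rw [hB]; field_simp
  set V : ℝ := ∏ p ∈ Nat.primesBelow M, sieveWeight P Q D p with hV
  have hV0 : 0 ≤ V := Finset.prod_nonneg fun p hp => sieveWeight_nonneg (Nat.mem_primesBelow.mp hp).2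
  have hVle : V ≤ E₀ * (Real.log P / Real.log Q) * Dprod := by
    have h1 : V ≤ E₀ * (Real.log P / Real.log (min Q (m : ℝ))) * ((D : ℝ) / Nat.totient D) := by
      have := prod_sieveWeight_le (m := m) hD1 hP hPQ hPm
      exact this
    rw [min_eq_left hQm] at h1
    exact h1.trans (mul_le_mul_of_nonneg_left hDle (by positivity))
  set Δ : ℕ := ∏ x ∈ A.offDiag, ((x.1 : ℤ) - x.2).natAbs with hΔ
  have hΔS : (Δ : ℝ) / Nat.totient Δ ≤ Spair := by
    have := cast_prod_div_totient_le A.offDiag (fun x => ((x.1 : ℤ) - x.2).natAbs) hd0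
    simpa only [hΔ, hSpair] using this
  have hΔ0 : (0 : ℝ) ≤ (Δ : ℝ) / Nat.totient Δ := by positivity
  -- the sifted count
  have hgood2 : (#((Icc 1 X).filter good) : ℝ) ≤
      C₀ * X * ((W ^ j * ((Δ : ℝ) / Nat.totient Δ) ^ j) * V) + (M : ℝ) ^ 2 := by
    by_cases hadm : ∀ p ∈ Nat.primesBelow M,
        #((if P ≤ (p : ℝ) ∧ (p : ℝ) ≤ Q then insert h A else A).image
          fun a => (p - a % p) % p) < p
    · have h1 := hcore X M A h P Q (by omega) hM2 hadm
      have h2 := prod_one_sub_card_le_mul A h P Q M hadm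
      have h3 := prod_one_sub_card_image_le A M
      have h4 : (∏ p ∈ Nat.primesBelow M, (1 - (#(A.image fun a => (p - a % p) % p) : ℝ) / p)) * V ≤
          (W ^ j * ((Δ : ℝ) / Nat.totient Δ) ^ j) * V := mul_le_mul_of_nonneg_right h3 hV0
      calc (#((Icc 1 X).filter good) : ℝ)
          ≤ C₀ * X * ∏ p ∈ Nat.primesBelow M,
              (1 - (#((if P ≤ (p : ℝ) ∧ (p : ℝ) ≤ Q then insert h A else A).image
                fun a => (p - a % p) % p) : ℝ) / p) + (M : ℝ) ^ 2 := h1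
        _ ≤ C₀ * X * ((W ^ j * ((Δ : ℝ) / Nat.totient Δ) ^ j) * V) + (M : ℝ) ^ 2 := by
            have := mul_le_mul_of_nonneg_left (h2.trans h4) (by positivity : 0 ≤ C₀ * (X : ℝ))
            linarith
    · push Not at hadm
      obtain ⟨p, hp, hfull⟩ := hadm
      have hempty := filter_sifted_eq_empty' (X := X) hp hfull
      have : #((Icc 1 X).filter good) = 0 := by
        rw [Finset.card_eq_zero]
        exact hempty
      rw [this, Nat.cast_zero]
      positivity
  -- assemble
  have hN3 : 3 ≤ 2 * X + 3 := by omega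
  have hlogN := natLog_two_add_one_le hN3
  have hLj : L ^ j ≤ L ^ k := pow_le_pow_right₀ hL1 hjk
  have hLj1 : L ^ j ≤ L ^ (k + 1) := pow_le_pow_right₀ hL1 (by omega)
  have hjR : (j : ℝ) ≤ k := by exact_mod_cast hjk
  -- term A
  have hA : C₀ * X * ((W ^ j * ((Δ : ℝ) / Nat.totient Δ) ^ j) * V) * L ^ j ≤
      C₀ * K₁ * E₀ * (X * Spair ^ k * (Real.log P / Real.log Q) * Dprod) := by
    have e1 : W ^ j * L ^ j ≤ K₁ := by
      rw [← mul_pow]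
      have hWL0 : 0 ≤ W * L := mul_nonneg hW0 hL0
      have hmax : (W * L) ^ j ≤ max 1 ((W * L) ^ k) := by
        rcases le_or_gt 1 (W * L) with h1 | h1
        · exact (pow_le_pow_right₀ h1 hjk).trans (le_max_right _ _)
        · exact (pow_le_one₀ hWL0 h1.le).trans (le_max_left _ _)
      exact hmax.trans (max_le_max le_rfl (pow_le_pow_left₀ hWL0 hWL k))
    have e2 : ((Δ : ℝ) / Nat.totient Δ) ^ j ≤ Spair ^ k :=
      (pow_le_pow_left₀ hΔ0 hΔS j).trans (pow_le_pow_right₀ hS1 hjk)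
    calc C₀ * X * ((W ^ j * ((Δ : ℝ) / Nat.totient Δ) ^ j) * V) * L ^ j
        = C₀ * X * (((W ^ j * L ^ j) * ((Δ : ℝ) / Nat.totient Δ) ^ j) * V) := by ring
      _ ≤ C₀ * X * ((K₁ * Spair ^ k) * (E₀ * (Real.log P / Real.log Q) * Dprod)) := by
          refine mul_le_mul_of_nonneg_left ?_ (by positivity)
          refine mul_le_mul (mul_le_mul e1 e2 (by positivity) (by positivity)) hVle hV0 ?_
          positivity
      _ = C₀ * K₁ * E₀ * (X * Spair ^ k * (Real.log P / Real.log Q) * Dprod) := by ring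
  -- `t³ = X^{3/4}`
  have ht3 : t ^ 3 = ((X : ℝ)) ^ (3 / 4 : ℝ) := by
    rw [ht, ← Real.rpow_natCast, ← Real.rpow_mul hX0.le]; norm_num
  have ht0 : 0 ≤ t := by linarith
  -- term B
  have hBt : (M : ℝ) ^ 2 * L ^ j ≤ 16 * K₃ * t ^ 3 := by
    calc (M : ℝ) ^ 2 * L ^ j ≤ (4 * t) ^ 2 * (K₃ * t) :=
          mul_le_mul (pow_le_pow_left₀ hM0 hMt 2) (hLj1.trans hLK) (pow_nonneg hL0 _) (by positivity)
      _ = 16 * K₃ * t ^ 3 := by ring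
  -- term C
  have hCt : L ^ j * ((j * (M * (Nat.log 2 (2 * X + 3) + 1)) : ℕ) : ℝ) ≤
      12 * (k + 1) * K₃ * t ^ 3 := by
    have e1 : ((j * (M * (Nat.log 2 (2 * X + 3) + 1)) : ℕ) : ℝ) ≤ k * ((4 * t) * (3 * L)) := by
      push_cast
      have hlogN' : ((Nat.log 2 (2 * X + 3) : ℕ) : ℝ) + 1 ≤ 3 * L := by
        have := hlogN; push_cast at this; rw [hL]; linarith
      have : (M : ℝ) * (((Nat.log 2 (2 * X + 3) : ℕ) : ℝ) + 1) ≤ (4 * t) * (3 * L) :=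
        mul_le_mul hMt hlogN' (by positivity) (by positivity)
      calc (j : ℝ) * ((M : ℝ) * ((Nat.log 2 (2 * X + 3) : ℕ) + 1)) ≤ k * ((4 * t) * (3 * L)) :=
            mul_le_mul hjR this (by positivity) (by positivity)
        _ = _ := by ring
    calc L ^ j * ((j * (M * (Nat.log 2 (2 * X + 3) + 1)) : ℕ) : ℝ)
        ≤ L ^ k * (k * ((4 * t) * (3 * L))) := mul_le_mul hLj e1 (by positivity) (pow_nonneg hL0 _)
      _ = 12 * k * t * L ^ (k + 1) := by ring
      _ ≤ 12 * k * t * (K₃ * t) := mul_le_mul_of_nonneg_left hLK (by positivity)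
      _ = 12 * k * K₃ * t ^ 2 := by ring
      _ ≤ 12 * (k + 1) * K₃ * t ^ 3 := by
          have h23 : t ^ 2 ≤ t ^ 3 := by nlinarith [sq_nonneg t]
          have hk : (12 * k * K₃ : ℝ) ≤ 12 * (k + 1) * K₃ := by
            have : (k : ℝ) ≤ k + 1 := by linarith
            exact mul_le_mul_of_nonneg_right (by linarith) hK₃.le
          exact mul_le_mul hk h23 (pow_nonneg ht0 2) (by positivity)
  -- total
  have hmain0 : 0 ≤ (X : ℝ) * Spair ^ k * (Real.log P / Real.log Q) * Dprod := by positivity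
  calc ∑ n ∈ Icc 1 X, (if HasPrimeFactorIn P Q (n + h) then (0 : ℝ) else ∏ a ∈ A, Λ (n + a))
      = ∑ n ∈ (Icc 1 X).filter good,
            (if HasPrimeFactorIn P Q (n + h) then (0 : ℝ) else ∏ a ∈ A, Λ (n + a)) +
          ∑ n ∈ (Icc 1 X).filter (fun n => ¬ good n),
            (if HasPrimeFactorIn P Q (n + h) then (0 : ℝ) else ∏ a ∈ A, Λ (n + a)) := hsplit
    _ ≤ #((Icc 1 X).filter good) * L ^ j +
          L ^ j * ((j * (M * (Nat.log 2 (2 * X + 3) + 1)) : ℕ) : ℝ) := add_le_add hgood1 hbad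
    _ ≤ (C₀ * X * ((W ^ j * ((Δ : ℝ) / Nat.totient Δ) ^ j) * V) + (M : ℝ) ^ 2) * L ^ j +
          L ^ j * ((j * (M * (Nat.log 2 (2 * X + 3) + 1)) : ℕ) : ℝ) := by
        gcongr
    _ = C₀ * X * ((W ^ j * ((Δ : ℝ) / Nat.totient Δ) ^ j) * V) * L ^ j + (M : ℝ) ^ 2 * L ^ j +
          L ^ j * ((j * (M * (Nat.log 2 (2 * X + 3) + 1)) : ℕ) : ℝ) := by ring
    _ ≤ C₀ * K₁ * E₀ * (X * Spair ^ k * (Real.log P / Real.log Q) * Dprod) +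
          16 * K₃ * t ^ 3 + 12 * (k + 1) * K₃ * t ^ 3 :=
        add_le_add (add_le_add hA hBt) hCt
    _ ≤ (C₀ * K₁ * E₀ + 16 * K₃ + 12 * (k + 1) * K₃) *
          (X * Spair ^ k * (Real.log P / Real.log Q) * Dprod + ((X : ℝ)) ^ (3 / 4 : ℝ)) := by
        rw [ht3]
        have h2 : 0 ≤ ((X : ℝ)) ^ (3 / 4 : ℝ) := by positivity
        nlinarith [mul_nonneg (by positivity : (0:ℝ) ≤ C₀ * K₁ * E₀) h2,
          mul_nonneg (by positivity : (0:ℝ) ≤ 16 * K₃ + 12 * (k + 1) * K₃) hmain0]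

end LichtmanTeravainen2022

end Literature.NumberTheory.Sieve
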